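import Literature.MathematicalPhysics.QuantumFieldTheory.Balaban1983to89.B4Thm112BoxHolder
import Literature.MathematicalPhysics.QuantumFieldTheory.Balaban1983to89.B4Thm19BoxNoCollar

/-!
# `Balaban1983to89.B4Thm112BoxNoCollar` — [Balaban1983RegularityDecay] THEOREM p. 573, THE `δG` CLAUSE
# (1.11)–(1.12) (value, derivative and Hölder members) ON NESTED BOXES, WITHOUT THE COLLAR HYPOTHESIS

statement-level skeleton of published theorems with citation tags; proofs where landed; nothing here is a claim about the Yang–Mills mass gap

Cell `lit-balaban` (HOME `run/shared/lean/pub/lit-balaban/`), seat `lit-balaban-r04` (B4 second reader), gen 15; v1.1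
(gen 16, docstring-only): the cell framing sentence above added (referee notes ref-4 S-B4-g46-1, ref-2 gen 64 N1);
the scoped budget `set_option maxHeartbeats 800000 in` before `thm112_holder_box_noCollar` is the build-hygiene lane's
one-line repair p329676 (the proof elaborates near 400000 heartbeats; 800000 = the lane's ceiling for a scoped budget)
and is kept.  No declaration, statement or proof is changed by v1.1.

Honest framing.  This module is step (4) of the collar-drop programme (HOME/GAPS.md G-B4-p17-02, r01 ruling
2026-08-22): the three members of the `δG_k(Ω,Ω₀,A) = G_k(Ω,A|Ω) − G_k(Ω₀,A)E` clause (1.11)–(1.12) of the THEOREM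
of p. 573 of [Balaban1983RegularityDecay] on every nested pair of boxes `Ω ⊂ Ω₀`, for a (1.7)-regular component
field `A_c` on `Ω₀` with only «e sufficiently small» — and WITHOUT the technical hypothesis «`A_c` constant on the
`K`-collars of `Ω₀` and of `Ω`» carried by `B4Thm112BoxValue.thm112_value_box_uniform`,
`B4Thm112BoxDeriv.thm112_deriv_box_uniform`, `B4Thm112BoxHolder.thm112_holder_box_uniform_unifK`.

The proofs are those three proofs VERBATIM (the resolvent identity `δG = G(Ω₀)·K(χ)·G(Ω)` of `B4Thm112BoxIdentity`,
the annular decomposition of `B4Thm112BoxDeriv`, the chain covariation of `B4Thm112BoxHolder`, the bookkeeping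
«(2M)⁻¹(dist + dist + dist) − 3» of p. 579), with the collared members (1.9)/(1.10) replaced by their collar-free
versions `B4Thm110BoxNoCollar.thm110_value_box_noCollar`, `B4Thm110BoxNoCollar.thm110_deriv_box_noCollar`,
`B4Thm19BoxNoCollar.thm19_holder_box_noCollar_all` (which rest on the face-bound Lemma 2.2 of
`B4Lemma22BoxNoCollar` / `B4Lemma22HolderNoCollar`: Neumann gauge + gauge covariance instead of «A′ = 0 on the
face-touching bonds»).  Nothing else changes: constants, moduli and thresholds are the same functions of the members'.

WHAT THIS MODULE PROVES (in full).
* **`thm112_value_box_noCollar`** — the value member: `∃ K` (`16 ≤ K`, `4 ∣ K`) `∃ c₀ > 0` `∀ (c, β)` `∃ e₁ > 0` such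
  that for all nested boxes with unit sides multiples of `K`, every (1.7)-regular `A_c` on `Ω₀`, `0 < e ≤ e₁`, every
  `x ∈ Ω`, source `f` supported in `P`, `|f| ≤ φ`:
  `|(G_k(Ω,A|Ω)f)(x)_i − (G_k(Ω₀,A)Ef)(x)_i| ≤ c₀·exp(−(D + D_b + D_f)/(2K))·φ`.
* **`thm112_deriv_box_noCollar`** — the derivative member, same quantifier prefix, for every bond `⟨x,x+ηe_ν⟩ ⊂ Ω`.
* **`thm112_holder_box_noCollar`** — the Hölder member, `K` chosen before `α` (`∃ K ∀ α ∈ [0,1) ∃ c_H`), all pairs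
  `x ≠ x′`.

## References
* [Balaban1983RegularityDecay] T. Balaban, *Regularity and decay of lattice Green's functions*, Comm. Math. Phys.
  89 (1983) 571–597 — Theorem p. 573, (1.9)–(1.12); proof pp. 579–581.
-/

namespace Literature.MathematicalPhysics.QuantumFieldTheory.Balaban1983to89.B4Thm112BoxNoCollar

open Literature.MathematicalPhysics.QuantumFieldTheory.Balaban1983to89.B4Reflection242 (boxDom mem_boxDom nbrs mem_nbrs
  nbrs_comm blk)
open Literature.MathematicalPhysics.QuantumFieldTheory.Balaban1983to89.B4GaugeCovariance
open Literature.MathematicalPhysics.QuantumFieldTheory.Balaban1983to89.B4Commutators25to211 (mulH opK)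
open Literature.MathematicalPhysics.QuantumFieldTheory.Balaban1983to89.B4ContourShift (supNorm supNorm_nonneg
  exists_supNorm_eq abs_le_supNorm)
open Literature.MathematicalPhysics.QuantumFieldTheory.Balaban1983to89.B4Lower18 (supNorm_sub_le_one_of_mem_nbrs)
open Literature.MathematicalPhysics.QuantumFieldTheory.Balaban1983to89.B4Lower18Regular (e1 baseEmb stairContour
  blkWt_ne_zero)
open Literature.MathematicalPhysics.QuantumFieldTheory.Balaban1983to89.B4Lower18RegularRegion (compField)
open Literature.MathematicalPhysics.QuantumFieldTheory.Balaban1983to89.B4Lemma21Region (siteNorm covDeriv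
  fld_covDeriv_mulVec_of_not_mem)
open Literature.MathematicalPhysics.QuantumFieldTheory.Balaban1983to89.B4Lemma22ReduceZero (Box opA greenA derivA)
open Literature.MathematicalPhysics.QuantumFieldTheory.Balaban1983to89.B4Lemma22Reduce231 (siteNorm_nonneg)
open Literature.MathematicalPhysics.QuantumFieldTheory.Balaban1983to89.B4Eq220CommutatorZeroBox (HSize)
open Literature.MathematicalPhysics.QuantumFieldTheory.Balaban1983to89.B4Eq220CommutatorField (kOp siteNorm_kOp_le)
open Literature.MathematicalPhysics.QuantumFieldTheory.Balaban1983to89.B4CubeFieldHyps22 (aSeq_window)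
open Literature.MathematicalPhysics.QuantumFieldTheory.Balaban1983to89.B4Ineq110WalkRoute (mulH_mulVec_apply)
open Literature.MathematicalPhysics.QuantumFieldTheory.Balaban1983to89.B4Green242Bridge (boxNbrs boxBlk)
open Literature.MathematicalPhysics.QuantumFieldTheory.Balaban1983to89.B4TwoBox120 (Fits emb emb_val extNbrs mem_extNbrs)
open Literature.MathematicalPhysics.QuantumFieldTheory.Balaban1983to89.B4Delta112ZeroBox (chi abs_chi_le_one
  abs_chi_sub_nbr_le abs_lap_chi_le exists_near_of_chi_ne_one chi_eq_zero_of_extNbrs supNorm_sub_le_of_boxBlk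
  card_boxBlk_eq two_le_pow)
open Literature.MathematicalPhysics.QuantumFieldTheory.Balaban1983to89.B4Thm110ZeroBox (supNorm_sub_le_sub_add_sub)
open Literature.MathematicalPhysics.QuantumFieldTheory.Balaban1983to89.B4TwoRegion120 (supNorm_sub_comm)
open Literature.MathematicalPhysics.QuantumFieldTheory.Balaban1983to89.B4SubBoxCarrier (subEmb inSub inSub_iff
  subEmb_injective)
open Literature.MathematicalPhysics.QuantumFieldTheory.Balaban1983to89.B4CubeGreenBox (subField)
open Literature.MathematicalPhysics.QuantumFieldTheory.Balaban1983to89.B4BoxCubeGeometry (posR)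
open Literature.MathematicalPhysics.QuantumFieldTheory.Balaban1983to89.B4RegionCubeCarrier (compField_add)
open Literature.MathematicalPhysics.QuantumFieldTheory.Balaban1983to89.B4Thm110BoxUniform (thm110_value_box_uniform)
open Literature.MathematicalPhysics.QuantumFieldTheory.Balaban1983to89.B4Thm110BoxDerivUniform (thm110_deriv_box_uniform)
open Literature.MathematicalPhysics.QuantumFieldTheory.Balaban1983to89.B4Thm112BoxIdentity (extV extV_subEmb
  extV_of_not_inSub Layer deltaG_decomp kOp_apply_eq_zero_of_const_near)
open Literature.MathematicalPhysics.QuantumFieldTheory.Balaban1983to89.B4Commutators25to211 (mulH opK fld_mulH_mulVec)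
open Literature.MathematicalPhysics.QuantumFieldTheory.Balaban1983to89.B4Lower18Regular (e1 baseEmb stairContour)
open Literature.MathematicalPhysics.QuantumFieldTheory.Balaban1983to89.B4Lemma21Region (siteNorm covDeriv
  fld_covDeriv_mulVec_of_mem)
open Literature.MathematicalPhysics.QuantumFieldTheory.Balaban1983to89.B4Eq220CommutatorField (kOp)
open Literature.MathematicalPhysics.QuantumFieldTheory.Balaban1983to89.B4Delta112ZeroBox (chi two_le_pow)
open Literature.MathematicalPhysics.QuantumFieldTheory.Balaban1983to89.B4Thm112BoxIdentity (extV extV_subEmb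
  extV_of_not_inSub Layer deltaG_decomp)
open Literature.MathematicalPhysics.QuantumFieldTheory.Balaban1983to89.B4Thm112BoxValue (chi_eq_zero_of_layer
  exists_out_of_chi_ne_one hsize_chi exists_coord_of_le_supNorm le_supNorm_of_coord supNorm_subEmb_sub_subEmb
  supNorm_sub_lt_box exists_out_of_kOp_ne_zero kOp_chi_apply_le max_half_mul_le max3_mul_le exp_bookkeeping)
open Literature.MathematicalPhysics.QuantumFieldTheory.Balaban1983to89.B4Commutators25to211 (mulH fld_mulH_mulVec)
open Literature.MathematicalPhysics.QuantumFieldTheory.Balaban1983to89.B4Lower18Regular (e1 baseEmb stairContour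
  transport_fieldLink)
open Literature.MathematicalPhysics.QuantumFieldTheory.Balaban1983to89.B4Lemma22Reduce231 (siteNorm_nonneg siteNorm_zero
  siteNorm_smul siteNorm_add_le)
open Literature.MathematicalPhysics.QuantumFieldTheory.Balaban1983to89.B4Lemma22HolderBox (IsNNChain)
open Literature.MathematicalPhysics.QuantumFieldTheory.Balaban1983to89.B4HolderChainTools (siteNorm_transport_mulVec
  fieldLink_mul_rev one_le_supNorm_of_ne)
open Literature.MathematicalPhysics.QuantumFieldTheory.Balaban1983to89.B4Green242Bridge (boxNbrs)
open Literature.MathematicalPhysics.QuantumFieldTheory.Balaban1983to89.B4Delta112ZeroBoxHolder (abs_chi_sub_le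
  abs_dchi_sub_le holderWeight_mul_le_one holderWeight_le_one)
open Literature.MathematicalPhysics.QuantumFieldTheory.Balaban1983to89.B4Thm19BoxHolderAll (abs_U_mulVec_apply_le)
open Literature.MathematicalPhysics.QuantumFieldTheory.Balaban1983to89.B4Thm19BoxHolderCut (transport_map pathEnd_map
  nbrs_subEmb_iff)
open Literature.MathematicalPhysics.QuantumFieldTheory.Balaban1983to89.B4Thm19BoxHolderUniform (thm19_holder_box_uniform_all
  thm19_holder_box_uniform_all_unifK)
open Literature.MathematicalPhysics.QuantumFieldTheory.Balaban1983to89.B4Thm112BoxIdentity (extV extV_subEmb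
  extV_of_not_inSub Layer)
open Literature.MathematicalPhysics.QuantumFieldTheory.Balaban1983to89.B4Thm112BoxValue (chi_eq_zero_of_layer
  exists_out_of_chi_ne_one hsize_chi exists_coord_of_le_supNorm le_supNorm_of_coord supNorm_subEmb_sub_subEmb
  max_half_mul_le exp_bookkeeping)
open Literature.MathematicalPhysics.QuantumFieldTheory.Balaban1983to89.B4Thm112BoxDeriv (restrV restrV_apply
  subEmb_add_e1 subEmb_add_e1_mem derivA_restrV_apply derivA_mulH_apply deltaG_decomp_fun source_facts annular_bound
  thm112_deriv_box_uniform)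
open Literature.MathematicalPhysics.QuantumFieldTheory.Balaban1983to89.B4Thm112BoxValue
open Literature.MathematicalPhysics.QuantumFieldTheory.Balaban1983to89.B4Thm112BoxDeriv
open Literature.MathematicalPhysics.QuantumFieldTheory.Balaban1983to89.B4Thm112BoxHolder
open Literature.MathematicalPhysics.QuantumFieldTheory.Balaban1983to89.B4Thm110BoxNoCollar (thm110_value_box_noCollar thm110_deriv_box_noCollar)
open Literature.MathematicalPhysics.QuantumFieldTheory.Balaban1983to89.B4Thm19BoxNoCollar (thm19_holder_box_noCollar_all)

open scoped Matrix

noncomputable section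

variable {ι : Type} [Fintype ι] [DecidableEq ι]

/-! ## §1. The value member of (1.11)·(1.12), no collar -/

/-- **THEOREM p. 573, THE `δG` CLAUSE (1.11)–(1.12), VALUE MEMBER, ON EVERY NESTED PAIR OF BOXES, WITH ONLY «e
SUFFICIENTLY SMALL», NO COLLAR**.  There are `K` (`16 ≤ K`, `4 ∣ K`) and `c₀ > 0` (depending on `d`, `ℓ`, `N`, the flow and
the windows only) such that for every `(c, β)` (`β > 0`) there is `e₁ > 0` with: for every scale `k ≥ 1`
(`n = (ℓ+1)^k`), `a ∈ [a₋,a₊]`, `m² ∈ [0,m²₊]`, every pair of boxes `Ω = n·o + Π[0,nMs) ⊂ Ω₀ = Π[0,nMb)` with unit sides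
multiples of `K`, every component field `A_c`, (1.7)-regular on `Ω₀` (NO collar hypothesis),
every `0 < e ≤ e₁` (coupling `e/n`), every site `x ∈ Ω`, every source `f` on `Ω` supported in `P` with `|f| ≤ φ`, and
all `D, D_b, D_f ≥ 0` dominated by the unit-lattice sup-distances from `x` to `P`, from `x` to `Ω₀ ∖ Ω`, and from `P` to
`Ω₀ ∖ Ω`:
`|(G_k(Ω,A|Ω)f)(x)_i − (G_k(Ω₀,A)Ef)(x)_i| ≤ c₀·exp(−(D + D_b + D_f)/(2K))·φ`
— «the inequalities (1.10) … with the additional factor (1.12)», for every `x ∈ Ω` («for rectangular parallelepipeds,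
the inequalities hold without any restrictions on the points»).
[cite: Balaban1983RegularityDecay, Theorem (1.10)–(1.12) p.573; p.579] -/
theorem thm112_value_box_noCollar (F : OrthFlow ι) {ℓ₁ : ℝ} (hℓ₁ : 0 ≤ ℓ₁)
    (hLip : ∀ t (v : ι → ℝ), ((F.U t - 1) *ᵥ v) ⬝ᵥ ((F.U t - 1) *ᵥ v) ≤ (ℓ₁ * t) ^ 2 * (v ⬝ᵥ v))
    (d ℓ : ℕ) (hd : 1 ≤ d) (hℓ : 1 ≤ ℓ) (amin aplus m2plus : ℝ) (ha : 0 < amin) :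
    ∃ K : ℕ, 16 ≤ K ∧ 4 ∣ K ∧ ∃ c₀ : ℝ, 0 < c₀ ∧ ∀ (creg β : ℝ), 0 ≤ creg → 0 < β →
      ∃ e₁ : ℝ, 0 < e₁ ∧ ∀ (k : ℕ), 1 ≤ k → ∀ (hn : 1 ≤ (ℓ + 1) ^ k) (a m2 : ℝ),
      amin ≤ a → a ≤ aplus → 0 ≤ m2 → m2 ≤ m2plus →
      ∀ (Mb Ms o : Fin (d + 1) → ℕ) (ho : ∀ i, o i + Ms i ≤ Mb i), (∀ i, 1 ≤ Ms i) → (∀ μ, K ∣ Mb μ) →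
        (∀ μ, K ∣ Ms μ) →
      ∀ (Ac : (Fin (d + 1) → ℤ) → Fin (d + 1) → ℝ) (e : ℝ), 0 < e → e ≤ e₁ →
        (∀ x ∈ Box d ℓ k Mb, ∀ μ ν : Fin (d + 1),
          |Ac (x + e1 μ) ν - Ac x ν| ≤ creg * e ^ (β - 1) / ((ℓ + 1) ^ k : ℕ)) →
      ∀ (x : ↥(Box d ℓ k Ms)) (P : ↥(Box d ℓ k Ms) → Prop) [DecidablePred P] (D Db Df : ℝ),
        0 ≤ D → 0 ≤ Db → 0 ≤ Df →
        (∀ x', P x' → ∃ μ, D ≤ |posR ℓ k Ms x μ - posR ℓ k Ms x' μ|) →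
        (∀ y : ↥(Box d ℓ k Mb), ¬ inSub ℓ k Mb Ms o y →
          ∃ μ, Db ≤ |posR ℓ k Mb (subEmb ℓ k Mb Ms o ho x) μ - posR ℓ k Mb y μ|) →
        (∀ x', P x' → ∀ y : ↥(Box d ℓ k Mb), ¬ inSub ℓ k Mb Ms o y →
          ∃ μ, Df ≤ |posR ℓ k Mb (subEmb ℓ k Mb Ms o ho x') μ - posR ℓ k Mb y μ|) →
      ∀ (f : ↥(Box d ℓ k Ms) × ι → ℝ), (∀ p, ¬ P p.1 → f p = 0) → ∀ (φ : ℝ), 0 ≤ φ → (∀ p, |f p| ≤ φ) →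
      ∀ i : ι,
        |(greenA d F (e / ((ℓ + 1) ^ k : ℕ)) ℓ k a m2 Ms (baseEmb hn Ms) (stairContour hn Ms)
              (fun u v : ↥(Box d ℓ k Ms) =>
                compField (fun w => Ac (w + fun i => (((ℓ + 1) ^ k : ℕ) : ℤ) * (o i : ℤ))) u.1 v.1) *ᵥ f) (x, i)
          - (greenA d F (e / ((ℓ + 1) ^ k : ℕ)) ℓ k a m2 Mb (baseEmb hn Mb) (stairContour hn Mb)
              (fun u v : ↥(Box d ℓ k Mb) => compField Ac u.1 v.1) *ᵥ extV ℓ k Mb Ms o f)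
              (subEmb ℓ k Mb Ms o ho x, i)|
          ≤ c₀ * Real.exp (-((D + Db + Df) / (2 * K))) * φ := by
  classical
  obtain ⟨Kv, hKv8, h4v, cv, hcv, HV⟩ := thm110_value_box_noCollar F hℓ₁ hLip d ℓ hd hℓ amin aplus m2plus ha
  obtain ⟨Kd, hKd8, -, cd, hcd, HD⟩ := thm110_deriv_box_noCollar F hℓ₁ hLip d ℓ hd hℓ amin aplus m2plus ha
  set K : ℕ := Kv * Kd with hK
  have hKvK : Kv ≤ K := by rw [hK]; nlinarith
  have hKdK : Kd ≤ K := by rw [hK]; nlinarith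
  have hK16 : 16 ≤ K := by rw [hK]; nlinarith
  have h4 : 4 ∣ K := dvd_mul_of_dvd_left h4v Kd
  have hKvr : (0 : ℝ) < Kv := by exact_mod_cast lt_of_lt_of_le (by norm_num) hKv8
  have hKdr : (0 : ℝ) < Kd := by exact_mod_cast lt_of_lt_of_le (by norm_num) hKd8
  have hKr : (0 : ℝ) < K := by exact_mod_cast lt_of_lt_of_le (by norm_num) hK16
  have hKvKr : (Kv : ℝ) ≤ K := by exact_mod_cast hKvK
  have hKdKr : (Kd : ℝ) ≤ K := by exact_mod_cast hKdK
  have hmonoV : ∀ {D' : ℝ}, 0 ≤ D' → Real.exp (-(D' / Kv)) ≤ Real.exp (-(D' / K)) := fun hD' =>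
    Real.exp_le_exp.mpr (neg_le_neg (div_le_div_of_nonneg_left hD' hKvr hKvKr))
  have hmonoD : ∀ {D' : ℝ}, 0 ≤ D' → Real.exp (-(D' / Kd)) ≤ Real.exp (-(D' / K)) := fun hD' =>
    Real.exp_le_exp.mpr (neg_le_neg (div_le_div_of_nonneg_left hD' hKdr hKdKr))
  -- the constants
  set N2 : ℝ := Real.sqrt (Fintype.card ι) with hN2
  have hN2_0 : 0 ≤ N2 := Real.sqrt_nonneg _
  set CK : ℝ := N2 * (16 * ((d : ℝ) + 1) * cd + (64 * ((d : ℝ) + 1) + 2 * aplus) * cv) with hCK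
  set r : ℝ := Real.exp (-(1 / (2 * K))) with hr
  have hr0 : 0 ≤ r := (Real.exp_pos _).le
  have hr1 : r < 1 := Real.exp_lt_one_iff.mpr (by
    have : 0 < 1 / (2 * (K : ℝ)) := by positivity
    linarith)
  have h1r : 0 < 1 - r := by linarith
  set c₀ : ℝ := 2 * cv * Real.exp (1 / K) + cv * |CK| * Real.exp (4 / K) / (1 - r) + 1 with hc₀
  have hc₀0 : 0 < c₀ := by positivity
  refine ⟨K, hK16, h4, c₀, hc₀0, fun creg β hcreg hβ => ?_⟩
  obtain ⟨ev, hev, HV'⟩ := HV creg β hcreg hβ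
  obtain ⟨ed, hed, HD'⟩ := HD creg β hcreg hβ
  refine ⟨min ev ed, lt_min hev hed, ?_⟩
  intro k hk hn a m2 ha1 ha2 hm1 hm2 Mb Ms o ho hMs hKMb hKMs Ac e he hle h17 x P _ D Db Df hD0 hDb0 hDf0
    hD hDb hDf f hfP φ hφ hf i
  -- scale facts
  have hn2 : 2 ≤ (ℓ + 1) ^ k := two_le_pow hℓ hk
  have hnr : (0 : ℝ) < (((ℓ + 1) ^ k : ℕ) : ℝ) := by exact_mod_cast hn
  have hnr1 : (1 : ℝ) ≤ (((ℓ + 1) ^ k : ℕ) : ℝ) := by exact_mod_cast hn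
  have hMb : ∀ i, 1 ≤ Mb i := fun i => le_trans (le_trans (hMs i) (Nat.le_add_left _ _)) (ho i)
  have ha' : 0 < a := lt_of_lt_of_le ha ha1
  have hlev : e ≤ ev := hle.trans (min_le_left _ _)
  have hled : e ≤ ed := hle.trans (min_le_right _ _)
  have hKvMb : ∀ μ, Kv ∣ Mb μ := fun μ => (Dvd.intro Kd rfl).trans (hKMb μ)
  have hKvMs : ∀ μ, Kv ∣ Ms μ := fun μ => (Dvd.intro Kd rfl).trans (hKMs μ)
  have hKdMs : ∀ μ, Kd ∣ Ms μ := fun μ => (Dvd.intro_left Kv rfl).trans (hKMs μ)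
  -- the translated component field of `Ω`
  set t : Fin (d + 1) → ℤ := fun i => (((ℓ + 1) ^ k : ℕ) : ℤ) * (o i : ℤ) with ht
  set Ac' : (Fin (d + 1) → ℤ) → Fin (d + 1) → ℝ := fun w => Ac (w + t) with hAc'
  have hsubF : subField ℓ k Mb Ms o ho (fun u v : ↥(Box d ℓ k Mb) => compField Ac u.1 v.1)
      = fun u v : ↥(Box d ℓ k Ms) => compField Ac' u.1 v.1 := by
    funext a' b'
    show compField Ac (subEmb ℓ k Mb Ms o ho a').1 (subEmb ℓ k Mb Ms o ho b').1 = compField Ac' a'.1 b'.1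
    have h1 : (subEmb ℓ k Mb Ms o ho a').1 = a'.1 + t := by funext j; simp [subEmb, ht]
    have h2 : (subEmb ℓ k Mb Ms o ho b').1 = b'.1 + t := by funext j; simp [subEmb, ht]
    rw [h1, h2, compField_add]
  -- regularity of the translated field
  have hmemT : ∀ w ∈ Box d ℓ k Ms, w + t ∈ Box d ℓ k Mb := fun w hw =>
    B4SubBoxCarrier.shift_mem_Box ℓ k Mb Ms o ho ⟨w, hw⟩
  have h17' : ∀ w ∈ Box d ℓ k Ms, ∀ μ ν : Fin (d + 1),
      |Ac' (w + e1 μ) ν - Ac' w ν| ≤ creg * e ^ (β - 1) / ((ℓ + 1) ^ k : ℕ) := by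
    intro w hw μ ν
    have := h17 (w + t) (hmemT w hw) μ ν
    simp only [hAc']
    rw [add_right_comm]
    exact this
  -- the members of (1.10) on `Ω` and `Ω₀`
  have VΩ := HV' k hk hn a m2 ha1 ha2 hm1 hm2 Ms hMs hKvMs Ac' e he hlev h17'
  have VΩ₀ := HV' k hk hn a m2 ha1 ha2 hm1 hm2 Mb hMb hKvMb Ac e he hlev h17
  have DΩ := HD' k hk hn a m2 ha1 ha2 hm1 hm2 Ms hMs hKdMs Ac' e he hled h17'
  -- the cutoff and the decomposition
  set χv : ↥(Box d ℓ k Ms) → ℝ := fun z => chi ((ℓ + 1) ^ k) Ms Mb (fun i => (o i : ℤ)) z.1 with hχv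
  have hχL : ∀ z, Layer ℓ k Mb Ms o ho z → χv z = 0 := fun z hz => chi_eq_zero_of_layer ℓ k Mb Ms o ho hn z hz
  have hχ01 : ∀ z, 0 ≤ χv z ∧ χv z ≤ 1 := fun z =>
    ⟨B4Delta112ZeroBox.chi_nonneg _ _ _ _ _, B4Delta112ZeroBox.chi_le_one _ _ _ _ _⟩
  have hdec := deltaG_decomp ℓ k Mb Ms o F (e / ((ℓ + 1) ^ k : ℕ)) ho hℓ hk hn ha' hm1
    (fun u v : ↥(Box d ℓ k Mb) => compField Ac u.1 v.1) χv hχL f x i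
  rw [hsubF] at hdec
  rw [hdec]
  -- abbreviations
  set GΩ := greenA d F (e / ((ℓ + 1) ^ k : ℕ)) ℓ k a m2 Ms (baseEmb hn Ms) (stairContour hn Ms)
    (fun u v : ↥(Box d ℓ k Ms) => compField Ac' u.1 v.1) with hGΩ
  set G₀ := greenA d F (e / ((ℓ + 1) ^ k : ℕ)) ℓ k a m2 Mb (baseEmb hn Mb) (stairContour hn Mb)
    (fun u v : ↥(Box d ℓ k Mb) => compField Ac u.1 v.1) with hG₀
  set u := GΩ *ᵥ f with hu
  set g := kOp F (e / ((ℓ + 1) ^ k : ℕ)) ((ℓ + 1) ^ k) (B1.aSeq a ((ℓ : ℝ) + 1) k) m2 Ms (baseEmb hn Ms)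
    (stairContour hn Ms) (fun u v : ↥(Box d ℓ k Ms) => compField Ac' u.1 v.1) χv *ᵥ u with hg
  set FF : ℝ := Real.exp (-((D + Db + Df) / (2 * K))) with hFF
  have hFF0 : 0 < FF := Real.exp_pos _
  -- distance tools
  have hDx : ∀ x', P x' → D * (((ℓ + 1) ^ k : ℕ) : ℝ) ≤ supNorm (x.1 - x'.1) := fun x' hx' => by
    obtain ⟨μ, hμ⟩ := hD x' hx'; exact le_supNorm_of_coord ℓ k Ms x x' hμ
  have hDbx : ∀ y : ↥(Box d ℓ k Mb), ¬ inSub ℓ k Mb Ms o y →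
      Db * (((ℓ + 1) ^ k : ℕ) : ℝ) ≤ supNorm ((subEmb ℓ k Mb Ms o ho x).1 - y.1) := fun y hy => by
    obtain ⟨μ, hμ⟩ := hDb y hy; exact le_supNorm_of_coord ℓ k Mb _ y hμ
  have hDfx : ∀ x', P x' → ∀ y : ↥(Box d ℓ k Mb), ¬ inSub ℓ k Mb Ms o y →
      Df * (((ℓ + 1) ^ k : ℕ) : ℝ) ≤ supNorm ((subEmb ℓ k Mb Ms o ho x').1 - y.1) := fun x' hx' y hy => by
    obtain ⟨μ, hμ⟩ := hDf x' hx' y hy; exact le_supNorm_of_coord ℓ k Mb _ y hμ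
  ---------------------------------------------------------------- T1
  have hT1 : |(1 - χv x) * u (x, i)| ≤ cv * Real.exp (1 / K) * FF * φ := by
    by_cases hx1 : χv x = 1
    · rw [hx1, sub_self, zero_mul, abs_zero]; positivity
    obtain ⟨y, hy, hdy⟩ := exists_out_of_chi_ne_one ℓ k Mb Ms o ho hn2 hMs x hx1
    have hDb1 : Db ≤ 1 := by
      have := (hDbx y hy).trans hdy
      exact le_of_mul_le_mul_right (by linarith only [this]) hnr
    set D₁ : ℝ := max ((D + (Df - 1)) / 2) 0 with hD₁
    have hD₁0 : 0 ≤ D₁ := le_max_right _ _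
    have hD₁P : ∀ x', P x' → ∃ μ, D₁ ≤ |posR ℓ k Ms x μ - posR ℓ k Ms x' μ| := by
      intro x' hx'
      refine exists_coord_of_le_supNorm ℓ k Ms x x' (max_half_mul_le hnr.le (hDx x' hx') ?_ (supNorm_nonneg _))
      have t1 := supNorm_sub_le_sub_add_sub (subEmb ℓ k Mb Ms o ho x').1 (subEmb ℓ k Mb Ms o ho x).1 y.1
      rw [supNorm_subEmb_sub_subEmb, supNorm_sub_comm x'.1] at t1
      have := hDfx x' hx' y hy
      rw [sub_mul, one_mul]
      linarith only [t1, this, hdy]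
    have hux := VΩ x P D₁ hD₁P f hfP φ hφ hf i
    have hexp : Real.exp (-(D₁ / Kv)) ≤ Real.exp (1 / K) * FF :=
      (hmonoV hD₁0).trans (exp_bookkeeping hKr (by
        have : (D + (Df - 1)) / 2 ≤ D₁ := le_max_left _ _
        linarith only [this, hDb1]))
    have h1χ : |1 - χv x| ≤ 1 := by
      obtain ⟨h0, h1⟩ := hχ01 x
      rw [abs_of_nonneg (by linarith only [h1])]; linarith only [h0]
    rw [abs_mul]
    calc |1 - χv x| * |u (x, i)| ≤ 1 * (cv * Real.exp (-(D₁ / Kv)) * φ) :=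
          mul_le_mul h1χ hux (abs_nonneg _) zero_le_one
      _ ≤ cv * (Real.exp (1 / K) * FF) * φ := by
          rw [one_mul]; exact mul_le_mul_of_nonneg_right (mul_le_mul_of_nonneg_left hexp hcv.le) hφ
      _ = cv * Real.exp (1 / K) * FF * φ := by ring
  ---------------------------------------------------------------- T3
  have hT3 : |(G₀ *ᵥ extV ℓ k Mb Ms o (mulH (ι := ι) (fun z => 1 - χv z) *ᵥ f)) (subEmb ℓ k Mb Ms o ho x, i)|
      ≤ cv * Real.exp (1 / K) * FF * φ := by
    set f₃ := mulH (ι := ι) (fun z => 1 - χv z) *ᵥ f with hf₃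
    have hf₃v : ∀ q, f₃ q = (1 - χv q.1) * f q := fun q => mulH_mulVec_apply _ _ q
    by_cases hP3 : ∃ a₀, P a₀ ∧ χv a₀ ≠ 1
    · obtain ⟨a₀, ha₀P, ha₀χ⟩ := hP3
      obtain ⟨y₀, hy₀, hd₀⟩ := exists_out_of_chi_ne_one ℓ k Mb Ms o ho hn2 hMs a₀ ha₀χ
      have hDf1 : Df ≤ 1 := by
        have := (hDfx a₀ ha₀P y₀ hy₀).trans hd₀
        exact le_of_mul_le_mul_right (by linarith only [this]) hnr
      set D₃ : ℝ := max ((D + (Db - 1)) / 2) 0 with hD₃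
      have hD₃0 : 0 ≤ D₃ := le_max_right _ _
      set P₃ : ↥(Box d ℓ k Mb) → Prop := fun y => ∃ a', subEmb ℓ k Mb Ms o ho a' = y ∧ P a' ∧ χv a' ≠ 1 with hP₃
      haveI hP₃d : DecidablePred P₃ := Classical.decPred P₃
      have hD₃P : ∀ y, P₃ y → ∃ μ, D₃ ≤ |posR ℓ k Mb (subEmb ℓ k Mb Ms o ho x) μ - posR ℓ k Mb y μ| := by
        rintro y ⟨a', rfl, ha'P, ha'χ⟩
        obtain ⟨y', hy', hd'⟩ := exists_out_of_chi_ne_one ℓ k Mb Ms o ho hn2 hMs a' ha'χ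
        refine exists_coord_of_le_supNorm ℓ k Mb _ _ (max_half_mul_le hnr.le ?_ ?_ (supNorm_nonneg _))
        · rw [supNorm_subEmb_sub_subEmb]; exact hDx a' ha'P
        · have t1 := supNorm_sub_le_sub_add_sub (subEmb ℓ k Mb Ms o ho x).1 (subEmb ℓ k Mb Ms o ho a').1 y'.1
          have := hDbx y' hy'
          rw [sub_mul, one_mul]
          linarith only [t1, this, hd']
      have hsupp : ∀ q : ↥(Box d ℓ k Mb) × ι, ¬ P₃ q.1 → extV ℓ k Mb Ms o f₃ q = 0 := by
        intro q hq
        by_cases hqi : inSub ℓ k Mb Ms o q.1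
        · obtain ⟨a', ha'⟩ := (inSub_iff ℓ k Mb Ms o ho _).mp hqi
          have hq' : q = (subEmb ℓ k Mb Ms o ho a', q.2) := Prod.ext ha'.symm rfl
          rw [hq', extV_subEmb, hf₃v]
          by_cases hPa : P a'
          · have hχa : χv a' = 1 := by
              by_contra hc; exact hq ⟨a', ha', hPa, hc⟩
            simp only [hχa, sub_self, zero_mul]
          · rw [hfP (a', q.2) hPa, mul_zero]
        · exact extV_of_not_inSub ℓ k Mb Ms o f₃ hqi
      have hbd : ∀ q : ↥(Box d ℓ k Mb) × ι, |extV ℓ k Mb Ms o f₃ q| ≤ φ := by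
        intro q
        by_cases hqi : inSub ℓ k Mb Ms o q.1
        · obtain ⟨a', ha'⟩ := (inSub_iff ℓ k Mb Ms o ho _).mp hqi
          have hq' : q = (subEmb ℓ k Mb Ms o ho a', q.2) := Prod.ext ha'.symm rfl
          rw [hq', extV_subEmb, hf₃v, abs_mul]
          obtain ⟨h0, h1⟩ := hχ01 a'
          calc |1 - χv a'| * |f (a', q.2)| ≤ 1 * φ :=
                mul_le_mul (by rw [abs_of_nonneg (by linarith only [h1])]; linarith only [h0]) (hf _)
                  (abs_nonneg _) zero_le_one
            _ = φ := one_mul φ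
        · rw [extV_of_not_inSub ℓ k Mb Ms o f₃ hqi, abs_zero]; exact hφ
      have h3 := VΩ₀ (subEmb ℓ k Mb Ms o ho x) P₃ D₃ hD₃P (extV ℓ k Mb Ms o f₃) hsupp φ hφ hbd i
      have hexp : Real.exp (-(D₃ / Kv)) ≤ Real.exp (1 / K) * FF :=
        (hmonoV hD₃0).trans (exp_bookkeeping hKr (by
          have : (D + (Db - 1)) / 2 ≤ D₃ := le_max_left _ _
          linarith only [this, hDf1]))
      calc |(G₀ *ᵥ extV ℓ k Mb Ms o f₃) (subEmb ℓ k Mb Ms o ho x, i)| ≤ cv * Real.exp (-(D₃ / Kv)) * φ := h3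
        _ ≤ cv * (Real.exp (1 / K) * FF) * φ :=
            mul_le_mul_of_nonneg_right (mul_le_mul_of_nonneg_left hexp hcv.le) hφ
        _ = cv * Real.exp (1 / K) * FF * φ := by ring
    · -- no source point off the plateau of `χ`: the third term vanishes
      push Not at hP3
      have hf₃0 : f₃ = 0 := by
        funext q
        rw [hf₃v]
        by_cases hPq : P q.1
        · rw [hP3 q.1 hPq, sub_self, zero_mul]; rfl
        · rw [hfP q hPq, mul_zero]; rfl
      have hE0 : extV ℓ k Mb Ms o f₃ = 0 := by
        funext q; rw [hf₃0]; simp [extV]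
      rw [hE0, Matrix.mulVec_zero, Pi.zero_apply, abs_zero]
      positivity
  ---------------------------------------------------------------- T2
  have hT2 : |(G₀ *ᵥ extV ℓ k Mb Ms o g) (subEmb ℓ k Mb Ms o ho x, i)|
      ≤ cv * |CK| * Real.exp (4 / K) / (1 - r) * FF * φ := by
    -- the unit annuli around `x`
    set mI : ↥(Box d ℓ k Ms) → ℕ := fun a' => ⌊supNorm (x.1 - a'.1) / (((ℓ + 1) ^ k : ℕ) : ℝ)⌋₊ with hmI
    set Mtop : ℕ := (∑ i, Ms i) + 1 with hMtop
    have hmI_le : ∀ a', (mI a' : ℝ) * (((ℓ + 1) ^ k : ℕ) : ℝ) ≤ supNorm (x.1 - a'.1) := by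
      intro a'
      have := Nat.floor_le (div_nonneg (supNorm_nonneg (x.1 - a'.1)) hnr.le)
      rw [hmI]
      exact (le_div_iff₀ hnr).mp this
    have hmI_gt : ∀ a', supNorm (x.1 - a'.1) < ((mI a' : ℝ) + 1) * (((ℓ + 1) ^ k : ℕ) : ℝ) := by
      intro a'
      have := Nat.lt_floor_add_one (supNorm (x.1 - a'.1) / (((ℓ + 1) ^ k : ℕ) : ℝ))
      rw [hmI]
      exact (div_lt_iff₀ hnr).mp this
    have hmI_lt : ∀ a', mI a' < Mtop := by
      intro a'
      have h1 := hmI_le a'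
      have h2 := supNorm_sub_lt_box ℓ k Ms x a'
      have h3 : (mI a' : ℝ) * (((ℓ + 1) ^ k : ℕ) : ℝ) < (((∑ i, Ms i : ℕ) : ℝ) + 1) * (((ℓ + 1) ^ k : ℕ) : ℝ) := by
        rw [add_mul, one_mul]
        linarith only [h1, h2, hnr1]
      have h4 : (mI a' : ℝ) < ((∑ i, Ms i : ℕ) : ℝ) + 1 := lt_of_mul_lt_mul_right h3 hnr.le
      rw [hMtop]
      exact_mod_cast h4
    set gm : ℕ → ↥(Box d ℓ k Ms) × ι → ℝ := fun m q => if mI q.1 = m then g q else 0 with hgm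
    have hsplit : extV ℓ k Mb Ms o g = ∑ m ∈ Finset.range Mtop, extV ℓ k Mb Ms o (gm m) := by
      funext q
      rw [Finset.sum_apply]
      by_cases hq : inSub ℓ k Mb Ms o q.1
      · simp only [extV, dif_pos hq, hgm]
        rw [Finset.sum_ite_eq, if_pos (Finset.mem_range.mpr (hmI_lt _))]
      · simp only [extV, dif_neg hq, Finset.sum_const_zero]
    -- the per-annulus sizes
    set Rm : ℕ → ℝ := fun m => max (max (D - m - 2) (Df - 3)) 0 with hRm
    have hRm0 : ∀ m, 0 ≤ Rm m := fun m => le_max_right _ _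
    set Φm : ℕ → ℝ := fun m => |CK| * Real.exp (-(Rm m / K)) * φ with hΦm
    have hΦm0 : ∀ m, 0 ≤ Φm m := fun m => by positivity
    -- (i) the source on the annulus `m`: size and support
    have hsrc : ∀ m (q : ↥(Box d ℓ k Mb) × ι),
        |extV ℓ k Mb Ms o (gm m) q| ≤ Φm m ∧
        (((m : ℝ) + 3 ≤ Db) → extV ℓ k Mb Ms o (gm m) q = 0) ∧
        (extV ℓ k Mb Ms o (gm m) q ≠ 0 → ∃ a', subEmb ℓ k Mb Ms o ho a' = q.1 ∧ mI a' = m) := by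
      intro m q
      by_cases hqi : inSub ℓ k Mb Ms o q.1
      swap
      · rw [extV_of_not_inSub ℓ k Mb Ms o _ hqi, abs_zero]
        exact ⟨hΦm0 m, fun _ => rfl, fun h => absurd rfl h⟩
      obtain ⟨a', ha'⟩ := (inSub_iff ℓ k Mb Ms o ho _).mp hqi
      have hq' : q = (subEmb ℓ k Mb Ms o ho a', q.2) := Prod.ext ha'.symm rfl
      rw [hq', extV_subEmb]
      simp only [hgm]
      by_cases hma : mI a' = m
      swap
      · rw [if_neg hma, abs_zero]
        exact ⟨hΦm0 m, fun _ => rfl, fun h => absurd rfl h⟩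
      rw [if_pos hma]
      refine ⟨?_, ?_, fun _ => ⟨a', rfl, hma⟩⟩
      · -- size
        by_cases hg0 : g (a', q.2) = 0
        · rw [hg0, abs_zero]; exact hΦm0 m
        obtain ⟨y, hy, hdy⟩ := exists_out_of_kOp_ne_zero ℓ k Mb Ms o F (e / ((ℓ + 1) ^ k : ℕ)) ho hn hn2 hMs
          (B1.aSeq a ((ℓ : ℝ) + 1) k) m2 (fun u v : ↥(Box d ℓ k Ms) => compField Ac' u.1 v.1) u a' q.2 hg0
        -- distances from the sites within one unit of `a'` to the source
        have hxa := hmI_gt a'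
        rw [hma] at hxa
        have hfar : ∀ a'' : ↥(Box d ℓ k Ms), supNorm (a'.1 - a''.1) ≤ (((ℓ + 1) ^ k : ℕ) : ℝ) →
            ∀ x', P x' → ∃ μ, Rm m ≤ |posR ℓ k Ms a'' μ - posR ℓ k Ms x' μ| := by
          intro a'' ha'' x' hx'
          refine exists_coord_of_le_supNorm ℓ k Ms a'' x' (max3_mul_le hnr.le ?_ ?_ (supNorm_nonneg _))
          · have t1 := supNorm_sub_le_sub_add_sub x.1 a'.1 x'.1
            have t2 := supNorm_sub_le_sub_add_sub a'.1 a''.1 x'.1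
            have := hDx x' hx'
            have e1' : ((m : ℝ) + 1) * (((ℓ + 1) ^ k : ℕ) : ℝ) = (m : ℝ) * (((ℓ + 1) ^ k : ℕ) : ℝ)
                + (((ℓ + 1) ^ k : ℕ) : ℝ) := by ring
            rw [e1'] at hxa
            rw [show (D - (m : ℝ) - 2) * (((ℓ + 1) ^ k : ℕ) : ℝ) = D * (((ℓ + 1) ^ k : ℕ) : ℝ)
                - (m : ℝ) * (((ℓ + 1) ^ k : ℕ) : ℝ) - 2 * (((ℓ + 1) ^ k : ℕ) : ℝ) by ring]
            linarith only [t1, t2, this, hxa, ha'']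
          · have t1 := supNorm_sub_le_sub_add_sub (subEmb ℓ k Mb Ms o ho x').1 (subEmb ℓ k Mb Ms o ho a'').1 y.1
            have t2 := supNorm_sub_le_sub_add_sub (subEmb ℓ k Mb Ms o ho a'').1 (subEmb ℓ k Mb Ms o ho a').1 y.1
            rw [supNorm_subEmb_sub_subEmb] at t1 t2
            rw [supNorm_sub_comm x'.1] at t1
            rw [supNorm_sub_comm a''.1] at t2
            have := hDfx x' hx' y hy
            rw [sub_mul]
            linarith only [t1, t2, this, hdy, ha'']
        have hu' : ∀ a'' : ↥(Box d ℓ k Ms), supNorm (a'.1 - a''.1) ≤ (((ℓ + 1) ^ k : ℕ) : ℝ) → ∀ j,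
            |u (a'', j)| ≤ cv * Real.exp (-(Rm m / K)) * φ := by
          intro a'' ha'' j
          have := VΩ a'' P (Rm m) (hfar a'' ha'') f hfP φ hφ hf j
          exact this.trans (mul_le_mul_of_nonneg_right
            (mul_le_mul_of_nonneg_left (hmonoV (hRm0 m)) hcv.le) hφ)
        have hDu' : ∀ a'' : ↥(Box d ℓ k Ms), supNorm (a'.1 - a''.1) ≤ (((ℓ + 1) ^ k : ℕ) : ℝ) → ∀ μ,
            a''.1 + e1 μ ∈ Box d ℓ k Ms → ∀ j,
            |(derivA d F (e / ((ℓ + 1) ^ k : ℕ)) ℓ k Ms (fun u v : ↥(Box d ℓ k Ms) => compField Ac' u.1 v.1) μ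
                *ᵥ u) (a'', j)| ≤ cd * Real.exp (-(Rm m / K)) * φ := by
          intro a'' ha'' μ hμ j
          have := DΩ μ a'' hμ P (Rm m) (hfar a'' ha'') f hfP φ hφ hf j
          exact this.trans (mul_le_mul_of_nonneg_right
            (mul_le_mul_of_nonneg_left (hmonoD (hRm0 m)) hcd.le) hφ)
        have hkey := kOp_chi_apply_le ℓ k Mb Ms o F (e / ((ℓ + 1) ^ k : ℕ)) hℓ hk hn hMs ha ha1 ha2 m2 Ac' u a'
          (by positivity) (by positivity) hu' hDu' q.2
        refine hkey.trans ?_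
        have hE0 : 0 ≤ Real.exp (-(Rm m / K)) * φ := by positivity
        have : N2 * (16 * ((d : ℝ) + 1) * (cd * Real.exp (-(Rm m / K)) * φ)
            + (64 * ((d : ℝ) + 1) + 2 * aplus) * (cv * Real.exp (-(Rm m / K)) * φ))
            = CK * (Real.exp (-(Rm m / K)) * φ) := by simp only [hCK]; ring
        rw [this]
        show CK * (Real.exp (-(Rm m / K)) * φ) ≤ |CK| * Real.exp (-(Rm m / K)) * φ
        calc CK * (Real.exp (-(Rm m / K)) * φ) ≤ |CK| * (Real.exp (-(Rm m / K)) * φ) :=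
              mul_le_mul_of_nonneg_right (le_abs_self CK) hE0
          _ = |CK| * Real.exp (-(Rm m / K)) * φ := by ring
      · -- support: within `m + 3` units of `Ω₀ ∖ Ω`
        intro hsmall
        by_contra hg0
        obtain ⟨y, hy, hdy⟩ := exists_out_of_kOp_ne_zero ℓ k Mb Ms o F (e / ((ℓ + 1) ^ k : ℕ)) ho hn hn2 hMs
          (B1.aSeq a ((ℓ : ℝ) + 1) k) m2 (fun u v : ↥(Box d ℓ k Ms) => compField Ac' u.1 v.1) u a' q.2 hg0
        have t1 := supNorm_sub_le_sub_add_sub (subEmb ℓ k Mb Ms o ho x).1 (subEmb ℓ k Mb Ms o ho a').1 y.1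
        rw [supNorm_subEmb_sub_subEmb] at t1
        have h1 := hDbx y hy
        have h2 := hmI_gt a'
        rw [hma] at h2
        have h3 := mul_le_mul_of_nonneg_right hsmall hnr.le
        have e1' : ((m : ℝ) + 1) * (((ℓ + 1) ^ k : ℕ) : ℝ) = (m : ℝ) * (((ℓ + 1) ^ k : ℕ) : ℝ)
            + (((ℓ + 1) ^ k : ℕ) : ℝ) := by ring
        have e2' : ((m : ℝ) + 3) * (((ℓ + 1) ^ k : ℕ) : ℝ) = (m : ℝ) * (((ℓ + 1) ^ k : ℕ) : ℝ)
            + 3 * (((ℓ + 1) ^ k : ℕ) : ℝ) := by ring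
        rw [e1'] at h2
        rw [e2'] at h3
        linarith only [t1, h1, h2, h3, hdy]
    -- (ii) the row form of (1.10) on `Ω₀`, per annulus
    set bm : ℕ → ℝ := fun m => if (m : ℝ) + 3 ≤ Db then 0 else cv * Real.exp (-((m : ℝ) / K)) * Φm m with hbm
    have hterm : ∀ m, |(G₀ *ᵥ extV ℓ k Mb Ms o (gm m)) (subEmb ℓ k Mb Ms o ho x, i)| ≤ bm m := by
      intro m
      simp only [hbm]
      by_cases hsmall : (m : ℝ) + 3 ≤ Db
      · rw [if_pos hsmall]
        have h0 : extV ℓ k Mb Ms o (gm m) = 0 := funext fun q => (hsrc m q).2.1 hsmall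
        rw [h0, Matrix.mulVec_zero, Pi.zero_apply, abs_zero]
      rw [if_neg hsmall]
      set Pm : ↥(Box d ℓ k Mb) → Prop := fun y => ∃ a', subEmb ℓ k Mb Ms o ho a' = y ∧ mI a' = m with hPm
      haveI hPmd : DecidablePred Pm := Classical.decPred Pm
      have hDm : ∀ y, Pm y → ∃ μ, (m : ℝ) ≤ |posR ℓ k Mb (subEmb ℓ k Mb Ms o ho x) μ - posR ℓ k Mb y μ| := by
        rintro y ⟨a', rfl, hma⟩
        refine exists_coord_of_le_supNorm ℓ k Mb _ _ ?_
        rw [supNorm_subEmb_sub_subEmb, ← hma]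
        exact hmI_le a'
      have hsupp : ∀ q : ↥(Box d ℓ k Mb) × ι, ¬ Pm q.1 → extV ℓ k Mb Ms o (gm m) q = 0 := by
        intro q hq
        by_contra h0
        exact hq ((hsrc m q).2.2 h0)
      have h3 := VΩ₀ (subEmb ℓ k Mb Ms o ho x) Pm (m : ℝ) hDm (extV ℓ k Mb Ms o (gm m)) hsupp (Φm m) (hΦm0 m)
        (fun q => (hsrc m q).1) i
      exact h3.trans (mul_le_mul_of_nonneg_right
        (mul_le_mul_of_nonneg_left (hmonoV (Nat.cast_nonneg m)) hcv.le) (hΦm0 m))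
    -- (iii) the geometric series in the annulus index
    set m₀ : ℕ := ⌈Db - 3⌉₊ with hm₀
    have hbm_le : ∀ m, bm m ≤ cv * |CK| * φ * Real.exp (-((D + Df - 5) / (2 * K)))
        * (if m₀ ≤ m then r ^ m else 0) := by
      intro m
      simp only [hbm]
      by_cases hsmall : (m : ℝ) + 3 ≤ Db
      · rw [if_pos hsmall]
        split_ifs <;> positivity
      rw [if_neg hsmall]
      have hm0m : m₀ ≤ m := by
        rw [hm₀]
        exact Nat.ceil_le.mpr (by push Not at hsmall; linarith only [hsmall])
      rw [if_pos hm0m]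
      have hrm : r ^ m = Real.exp (-((m : ℝ) / (2 * K))) := by
        rw [hr, ← Real.exp_nat_mul]; congr 1; ring
      rw [hrm]
      have hexp : Real.exp (-((m : ℝ) / K)) * Real.exp (-(Rm m / K))
          ≤ Real.exp (-((D + Df - 5) / (2 * K))) * Real.exp (-((m : ℝ) / (2 * K))) := by
        rw [← Real.exp_add, ← Real.exp_add, Real.exp_le_exp]
        have hR : ((D - m - 2) + (Df - 3)) / 2 ≤ Rm m := by
          have h1 : D - m - 2 ≤ Rm m := (le_max_left _ _).trans (le_max_left _ _)
          have h2 : Df - 3 ≤ Rm m := (le_max_right _ _).trans (le_max_left _ _)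
          linarith only [h1, h2]
        rw [show -((m : ℝ) / K) + -(Rm m / K) = (-(m + Rm m)) / K by ring,
          show -((D + Df - 5) / (2 * K)) + -((m : ℝ) / (2 * K)) = (-((D + Df - 5) / 2 + m / 2)) / K by
            field_simp; ring]
        exact div_le_div_of_nonneg_right (by linarith only [hR]) hKr.le
      calc cv * Real.exp (-((m : ℝ) / K)) * (|CK| * Real.exp (-(Rm m / K)) * φ)
          = cv * |CK| * φ * (Real.exp (-((m : ℝ) / K)) * Real.exp (-(Rm m / K))) := by ring
        _ ≤ cv * |CK| * φ * (Real.exp (-((D + Df - 5) / (2 * K))) * Real.exp (-((m : ℝ) / (2 * K)))) :=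
            mul_le_mul_of_nonneg_left hexp (by positivity)
        _ = cv * |CK| * φ * Real.exp (-((D + Df - 5) / (2 * K))) * Real.exp (-((m : ℝ) / (2 * K))) := by ring
    have hgeom : ∑ m ∈ Finset.range Mtop, (if m₀ ≤ m then r ^ m else 0) ≤ r ^ m₀ / (1 - r) := by
      rw [← Finset.sum_filter]
      have hsub : (Finset.range Mtop).filter (fun m => m₀ ≤ m) ⊆ Finset.Ico m₀ Mtop := by
        intro m hm
        rw [Finset.mem_filter, Finset.mem_range] at hm
        exact Finset.mem_Ico.mpr ⟨hm.2, hm.1⟩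
      refine (Finset.sum_le_sum_of_subset_of_nonneg hsub fun m _ _ => pow_nonneg hr0 m).trans ?_
      exact geom_sum_Ico_le_of_lt_one hr0 hr1
    have hrm₀ : r ^ m₀ ≤ Real.exp (-((Db - 3) / (2 * K))) := by
      rw [hr, ← Real.exp_nat_mul, Real.exp_le_exp]
      have : Db - 3 ≤ (m₀ : ℝ) := Nat.le_ceil _
      rw [show ((m₀ : ℕ) : ℝ) * -(1 / (2 * (K : ℝ))) = (-(m₀ : ℝ)) / (2 * K) by ring,
        show -((Db - 3) / (2 * (K : ℝ))) = (-(Db - 3)) / (2 * K) by ring]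
      exact div_le_div_of_nonneg_right (by linarith only [this]) (by positivity)
    -- assemble T2
    rw [hsplit, Matrix.mulVec_sum, Finset.sum_apply]
    refine (Finset.abs_sum_le_sum_abs _ _).trans ?_
    calc ∑ m ∈ Finset.range Mtop, |(G₀ *ᵥ extV ℓ k Mb Ms o (gm m)) (subEmb ℓ k Mb Ms o ho x, i)|
        ≤ ∑ m ∈ Finset.range Mtop, cv * |CK| * φ * Real.exp (-((D + Df - 5) / (2 * K)))
            * (if m₀ ≤ m then r ^ m else 0) :=
          Finset.sum_le_sum fun m _ => (hterm m).trans (hbm_le m)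
      _ = cv * |CK| * φ * Real.exp (-((D + Df - 5) / (2 * K)))
            * ∑ m ∈ Finset.range Mtop, (if m₀ ≤ m then r ^ m else 0) := by rw [Finset.mul_sum]
      _ ≤ cv * |CK| * φ * Real.exp (-((D + Df - 5) / (2 * K))) * (Real.exp (-((Db - 3) / (2 * K))) / (1 - r)) := by
          refine mul_le_mul_of_nonneg_left (hgeom.trans ?_) (by positivity)
          exact div_le_div_of_nonneg_right hrm₀ h1r.le
      _ = cv * |CK| * Real.exp (4 / K) / (1 - r) * FF * φ := by
          have : Real.exp (-((D + Df - 5) / (2 * K))) * Real.exp (-((Db - 3) / (2 * K)))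
              = Real.exp (4 / K) * FF := by
            rw [hFF, ← Real.exp_add, ← Real.exp_add]; congr 1; field_simp; ring
          calc cv * |CK| * φ * Real.exp (-((D + Df - 5) / (2 * K))) * (Real.exp (-((Db - 3) / (2 * K))) / (1 - r))
              = cv * |CK| * φ * (Real.exp (-((D + Df - 5) / (2 * K))) * Real.exp (-((Db - 3) / (2 * K))))
                  / (1 - r) := by ring
            _ = cv * |CK| * Real.exp (4 / K) / (1 - r) * FF * φ := by rw [this]; ring
  ---------------------------------------------------------------- total
  have hsum : |(1 - χv x) * u (x, i) - (G₀ *ᵥ extV ℓ k Mb Ms o g) (subEmb ℓ k Mb Ms o ho x, i)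
      - (G₀ *ᵥ extV ℓ k Mb Ms o (mulH (ι := ι) (fun z => 1 - χv z) *ᵥ f)) (subEmb ℓ k Mb Ms o ho x, i)|
      ≤ cv * Real.exp (1 / K) * FF * φ + cv * |CK| * Real.exp (4 / K) / (1 - r) * FF * φ
        + cv * Real.exp (1 / K) * FF * φ := by
    refine (abs_sub _ _).trans (add_le_add ((abs_sub _ _).trans (add_le_add hT1 hT2)) hT3)
  refine hsum.trans ?_
  have : cv * Real.exp (1 / K) * FF * φ + cv * |CK| * Real.exp (4 / K) / (1 - r) * FF * φ
      + cv * Real.exp (1 / K) * FF * φ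
      = (2 * cv * Real.exp (1 / K) + cv * |CK| * Real.exp (4 / K) / (1 - r)) * FF * φ := by ring
  rw [this, hFF]
  refine mul_le_mul_of_nonneg_right (mul_le_mul_of_nonneg_right ?_ hFF0.le) hφ
  rw [hc₀]
  exact le_add_of_nonneg_right zero_le_one

/-! ## §2. The derivative member of (1.11)·(1.12), no collar -/

/-- **THEOREM p. 573, THE `δG` CLAUSE (1.11)–(1.12), DERIVATIVE MEMBER, ON EVERY NESTED PAIR OF BOXES, WITH ONLY «e
SUFFICIENTLY SMALL», NO COLLAR**.  There are `K` (`16 ≤ K`, `4 ∣ K`) and `c₁ > 0` (depending on `d`, `ℓ`, `N`, the flow and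
the windows only) such that for every `(c, β)` (`β > 0`) there is `e₁ > 0` with: for every scale `k ≥ 1`, `a ∈ [a₋,a₊]`,
`m² ∈ [0,m²₊]`, every pair of boxes `Ω = n·o + Π[0,nMs) ⊂ Ω₀ = Π[0,nMb)` with unit sides multiples of `K`, every
component field `A_c`, (1.7)-regular on `Ω₀` (NO collar hypothesis), every `0 < e ≤ e₁`
(coupling `e/n`), every bond `⟨x, x + ηe_ν⟩ ⊂ Ω`, every source `f` on `Ω` supported in `P` with `|f| ≤ φ`, and all
`D, D_b, D_f ≥ 0` below the unit-lattice sup-distances from `x` to `P`, from `x` to `Ω₀ ∖ Ω`, from `P` to `Ω₀ ∖ Ω`: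
`|(D^η_{A,ν}G_k(Ω,A|Ω)f)(x)_i − (D^η_{A,ν}G_k(Ω₀,A)Ef)(x)_i| ≤ c₁·exp(−(D + D_b + D_f)/(2K))·φ`.
[cite: Balaban1983RegularityDecay, Theorem (1.10)–(1.12) p.573; p.579] -/
theorem thm112_deriv_box_noCollar (F : OrthFlow ι) {ℓ₁ : ℝ} (hℓ₁ : 0 ≤ ℓ₁)
    (hLip : ∀ t (v : ι → ℝ), ((F.U t - 1) *ᵥ v) ⬝ᵥ ((F.U t - 1) *ᵥ v) ≤ (ℓ₁ * t) ^ 2 * (v ⬝ᵥ v))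
    (d ℓ : ℕ) (hd : 1 ≤ d) (hℓ : 1 ≤ ℓ) (amin aplus m2plus : ℝ) (ha : 0 < amin) :
    ∃ K : ℕ, 16 ≤ K ∧ 4 ∣ K ∧ ∃ c₁ : ℝ, 0 < c₁ ∧ ∀ (creg β : ℝ), 0 ≤ creg → 0 < β →
      ∃ e₁ : ℝ, 0 < e₁ ∧ ∀ (k : ℕ), 1 ≤ k → ∀ (hn : 1 ≤ (ℓ + 1) ^ k) (a m2 : ℝ),
      amin ≤ a → a ≤ aplus → 0 ≤ m2 → m2 ≤ m2plus →
      ∀ (Mb Ms o : Fin (d + 1) → ℕ) (ho : ∀ i, o i + Ms i ≤ Mb i), (∀ i, 1 ≤ Ms i) → (∀ μ, K ∣ Mb μ) →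
        (∀ μ, K ∣ Ms μ) →
      ∀ (Ac : (Fin (d + 1) → ℤ) → Fin (d + 1) → ℝ) (e : ℝ), 0 < e → e ≤ e₁ →
        (∀ x ∈ Box d ℓ k Mb, ∀ μ ν : Fin (d + 1),
          |Ac (x + e1 μ) ν - Ac x ν| ≤ creg * e ^ (β - 1) / ((ℓ + 1) ^ k : ℕ)) →
      ∀ (ν : Fin (d + 1)) (x : ↥(Box d ℓ k Ms)), x.1 + e1 ν ∈ Box d ℓ k Ms →
      ∀ (P : ↥(Box d ℓ k Ms) → Prop) [DecidablePred P] (D Db Df : ℝ),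
        0 ≤ D → 0 ≤ Db → 0 ≤ Df →
        (∀ x', P x' → ∃ μ, D ≤ |posR ℓ k Ms x μ - posR ℓ k Ms x' μ|) →
        (∀ y : ↥(Box d ℓ k Mb), ¬ inSub ℓ k Mb Ms o y →
          ∃ μ, Db ≤ |posR ℓ k Mb (subEmb ℓ k Mb Ms o ho x) μ - posR ℓ k Mb y μ|) →
        (∀ x', P x' → ∀ y : ↥(Box d ℓ k Mb), ¬ inSub ℓ k Mb Ms o y →
          ∃ μ, Df ≤ |posR ℓ k Mb (subEmb ℓ k Mb Ms o ho x') μ - posR ℓ k Mb y μ|) →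
      ∀ (f : ↥(Box d ℓ k Ms) × ι → ℝ), (∀ p, ¬ P p.1 → f p = 0) → ∀ (φ : ℝ), 0 ≤ φ → (∀ p, |f p| ≤ φ) →
      ∀ i : ι,
        |(derivA d F (e / ((ℓ + 1) ^ k : ℕ)) ℓ k Ms
              (fun u v : ↥(Box d ℓ k Ms) =>
                compField (fun w => Ac (w + fun i => (((ℓ + 1) ^ k : ℕ) : ℤ) * (o i : ℤ))) u.1 v.1) ν
            *ᵥ (greenA d F (e / ((ℓ + 1) ^ k : ℕ)) ℓ k a m2 Ms (baseEmb hn Ms) (stairContour hn Ms)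
              (fun u v : ↥(Box d ℓ k Ms) =>
                compField (fun w => Ac (w + fun i => (((ℓ + 1) ^ k : ℕ) : ℤ) * (o i : ℤ))) u.1 v.1) *ᵥ f)) (x, i)
          - (derivA d F (e / ((ℓ + 1) ^ k : ℕ)) ℓ k Mb (fun u v : ↥(Box d ℓ k Mb) => compField Ac u.1 v.1) ν
            *ᵥ (greenA d F (e / ((ℓ + 1) ^ k : ℕ)) ℓ k a m2 Mb (baseEmb hn Mb) (stairContour hn Mb)
              (fun u v : ↥(Box d ℓ k Mb) => compField Ac u.1 v.1) *ᵥ extV ℓ k Mb Ms o f))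
              (subEmb ℓ k Mb Ms o ho x, i)|
          ≤ c₁ * Real.exp (-((D + Db + Df) / (2 * K))) * φ := by
  classical
  obtain ⟨Kv, hKv8, h4v, cv, hcv, HV⟩ := thm110_value_box_noCollar F hℓ₁ hLip d ℓ hd hℓ amin aplus m2plus ha
  obtain ⟨Kd, hKd8, -, cd, hcd, HD⟩ := thm110_deriv_box_noCollar F hℓ₁ hLip d ℓ hd hℓ amin aplus m2plus ha
  set K : ℕ := Kv * Kd with hK
  have hKvK : Kv ≤ K := by rw [hK]; nlinarith
  have hKdK : Kd ≤ K := by rw [hK]; nlinarith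
  have hK16 : 16 ≤ K := by rw [hK]; nlinarith
  have h4 : 4 ∣ K := dvd_mul_of_dvd_left h4v Kd
  have hKvr : (0 : ℝ) < Kv := by exact_mod_cast lt_of_lt_of_le (by norm_num) hKv8
  have hKdr : (0 : ℝ) < Kd := by exact_mod_cast lt_of_lt_of_le (by norm_num) hKd8
  have hKr : (0 : ℝ) < K := by exact_mod_cast lt_of_lt_of_le (by norm_num) hK16
  have hKvKr : (Kv : ℝ) ≤ K := by exact_mod_cast hKvK
  have hKdKr : (Kd : ℝ) ≤ K := by exact_mod_cast hKdK
  have hmonoV : ∀ {D' : ℝ}, 0 ≤ D' → Real.exp (-(D' / Kv)) ≤ Real.exp (-(D' / K)) := fun hD' =>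
    Real.exp_le_exp.mpr (neg_le_neg (div_le_div_of_nonneg_left hD' hKvr hKvKr))
  have hmonoD : ∀ {D' : ℝ}, 0 ≤ D' → Real.exp (-(D' / Kd)) ≤ Real.exp (-(D' / K)) := fun hD' =>
    Real.exp_le_exp.mpr (neg_le_neg (div_le_div_of_nonneg_left hD' hKdr hKdKr))
  -- the constants
  set CK : ℝ := |Real.sqrt (Fintype.card ι) * (16 * ((d : ℝ) + 1) * cd + (64 * ((d : ℝ) + 1) + 2 * aplus) * cv)|
    with hCK
  have hCK0 : 0 ≤ CK := abs_nonneg _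
  set r : ℝ := Real.exp (-(1 / (2 * K))) with hr
  have hr1 : r < 1 := Real.exp_lt_one_iff.mpr (by
    have : 0 < 1 / (2 * (K : ℝ)) := by positivity
    linarith only [this])
  have h1r : 0 < 1 - r := by linarith only [hr1]
  set c₁ : ℝ := (cd + 8 * cv) * Real.exp (2 / K) + cd * Real.exp (1 / K) + cd * CK * Real.exp (4 / K) / (1 - r) + 1
    with hc₁
  have hc₁0 : 0 < c₁ := by positivity
  refine ⟨K, hK16, h4, c₁, hc₁0, fun creg β hcreg hβ => ?_⟩
  obtain ⟨ev, hev, HV'⟩ := HV creg β hcreg hβ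
  obtain ⟨ed, hed, HD'⟩ := HD creg β hcreg hβ
  refine ⟨min ev ed, lt_min hev hed, ?_⟩
  intro k hk hn a m2 ha1 ha2 hm1 hm2 Mb Ms o ho hMs hKMb hKMs Ac e he hle h17 ν x hxν P _ D Db Df hD0 hDb0
    hDf0 hD hDb hDf f hfP φ hφ hf i
  -- scale facts
  have hn2 : 2 ≤ (ℓ + 1) ^ k := two_le_pow hℓ hk
  have hnr : (0 : ℝ) < (((ℓ + 1) ^ k : ℕ) : ℝ) := by exact_mod_cast hn
  have hnr1 : (1 : ℝ) ≤ (((ℓ + 1) ^ k : ℕ) : ℝ) := by exact_mod_cast hn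
  have hMb : ∀ i, 1 ≤ Mb i := fun i => le_trans (le_trans (hMs i) (Nat.le_add_left _ _)) (ho i)
  have ha' : 0 < a := lt_of_lt_of_le ha ha1
  have hlev : e ≤ ev := hle.trans (min_le_left _ _)
  have hled : e ≤ ed := hle.trans (min_le_right _ _)
  have hKvMb : ∀ μ, Kv ∣ Mb μ := fun μ => (Dvd.intro Kd rfl).trans (hKMb μ)
  have hKdMb : ∀ μ, Kd ∣ Mb μ := fun μ => (Dvd.intro_left Kv rfl).trans (hKMb μ)
  have hKvMs : ∀ μ, Kv ∣ Ms μ := fun μ => (Dvd.intro Kd rfl).trans (hKMs μ)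
  have hKdMs : ∀ μ, Kd ∣ Ms μ := fun μ => (Dvd.intro_left Kv rfl).trans (hKMs μ)
  -- the translated component field of `Ω`
  set t : Fin (d + 1) → ℤ := fun i => (((ℓ + 1) ^ k : ℕ) : ℤ) * (o i : ℤ) with ht
  set Ac' : (Fin (d + 1) → ℤ) → Fin (d + 1) → ℝ := fun w => Ac (w + t) with hAc'
  have hsubF : subField ℓ k Mb Ms o ho (fun u v : ↥(Box d ℓ k Mb) => compField Ac u.1 v.1)
      = fun u v : ↥(Box d ℓ k Ms) => compField Ac' u.1 v.1 := by
    funext a' b'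
    show compField Ac (subEmb ℓ k Mb Ms o ho a').1 (subEmb ℓ k Mb Ms o ho b').1 = compField Ac' a'.1 b'.1
    have h1 : (subEmb ℓ k Mb Ms o ho a').1 = a'.1 + t := by funext j; simp [subEmb, ht]
    have h2 : (subEmb ℓ k Mb Ms o ho b').1 = b'.1 + t := by funext j; simp [subEmb, ht]
    rw [h1, h2, compField_add]
  have hmemT : ∀ w ∈ Box d ℓ k Ms, w + t ∈ Box d ℓ k Mb := fun w hw =>
    B4SubBoxCarrier.shift_mem_Box ℓ k Mb Ms o ho ⟨w, hw⟩
  have h17' : ∀ w ∈ Box d ℓ k Ms, ∀ μ ν : Fin (d + 1),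
      |Ac' (w + e1 μ) ν - Ac' w ν| ≤ creg * e ^ (β - 1) / ((ℓ + 1) ^ k : ℕ) := by
    intro w hw μ ν
    have := h17 (w + t) (hmemT w hw) μ ν
    simp only [hAc']
    rw [add_right_comm]
    exact this
  -- the members of (1.10) on `Ω` and `Ω₀`
  have VΩ := HV' k hk hn a m2 ha1 ha2 hm1 hm2 Ms hMs hKvMs Ac' e he hlev h17'
  have DΩ := HD' k hk hn a m2 ha1 ha2 hm1 hm2 Ms hMs hKdMs Ac' e he hled h17'
  have DΩ₀ := HD' k hk hn a m2 ha1 ha2 hm1 hm2 Mb hMb hKdMb Ac e he hled h17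
  -- the cutoff and the decomposition
  set χv : ↥(Box d ℓ k Ms) → ℝ := fun z => chi ((ℓ + 1) ^ k) Ms Mb (fun i => (o i : ℤ)) z.1 with hχv
  have hχL : ∀ z, Layer ℓ k Mb Ms o ho z → χv z = 0 := fun z hz => chi_eq_zero_of_layer ℓ k Mb Ms o ho hn z hz
  have hχ01 : ∀ z, 0 ≤ χv z ∧ χv z ≤ 1 := fun z =>
    ⟨B4Delta112ZeroBox.chi_nonneg _ _ _ _ _, B4Delta112ZeroBox.chi_le_one _ _ _ _ _⟩
  have hsz := hsize_chi ℓ k Mb Ms o hn2 hMs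
  have hdec := deltaG_decomp_fun ℓ k Mb Ms o F (e / ((ℓ + 1) ^ k : ℕ)) ho hℓ hk hn ha' hm1
    (fun u v : ↥(Box d ℓ k Mb) => compField Ac u.1 v.1) χv hχL f
  rw [hsubF] at hdec
  -- abbreviations
  set GΩ := greenA d F (e / ((ℓ + 1) ^ k : ℕ)) ℓ k a m2 Ms (baseEmb hn Ms) (stairContour hn Ms)
    (fun u v : ↥(Box d ℓ k Ms) => compField Ac' u.1 v.1) with hGΩ
  set G₀ := greenA d F (e / ((ℓ + 1) ^ k : ℕ)) ℓ k a m2 Mb (baseEmb hn Mb) (stairContour hn Mb)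
    (fun u v : ↥(Box d ℓ k Mb) => compField Ac u.1 v.1) with hG₀
  set DνΩ := derivA d F (e / ((ℓ + 1) ^ k : ℕ)) ℓ k Ms (fun u v : ↥(Box d ℓ k Ms) => compField Ac' u.1 v.1) ν
    with hDνΩ
  set Dν₀ := derivA d F (e / ((ℓ + 1) ^ k : ℕ)) ℓ k Mb (fun u v : ↥(Box d ℓ k Mb) => compField Ac u.1 v.1) ν
    with hDν₀
  set u := GΩ *ᵥ f with hu
  set g := kOp F (e / ((ℓ + 1) ^ k : ℕ)) ((ℓ + 1) ^ k) (B1.aSeq a ((ℓ : ℝ) + 1) k) m2 Ms (baseEmb hn Ms)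
    (stairContour hn Ms) (fun u v : ↥(Box d ℓ k Ms) => compField Ac' u.1 v.1) χv *ᵥ u with hg
  set f₃ := mulH (ι := ι) (fun z => 1 - χv z) *ᵥ f with hf₃
  set FF : ℝ := Real.exp (-((D + Db + Df) / (2 * K))) with hFF
  have hFF0 : 0 < FF := Real.exp_pos _
  -- rewrite the left-hand side through the decomposition and `derivA_restrV_apply`
  have hrestr : ∀ w : ↥(Box d ℓ k Mb) × ι → ℝ,
      (DνΩ *ᵥ restrV ℓ k Mb Ms o ho w) (x, i) = (Dν₀ *ᵥ w) (subEmb ℓ k Mb Ms o ho x, i) := by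
    intro w
    have := derivA_restrV_apply ℓ k Mb Ms o F (e / ((ℓ + 1) ^ k : ℕ)) ho
      (fun u v : ↥(Box d ℓ k Mb) => compField Ac u.1 v.1) w ν x hxν i
    rw [hsubF] at this
    exact this
  have hLHS : (DνΩ *ᵥ u) (x, i) - (Dν₀ *ᵥ (G₀ *ᵥ extV ℓ k Mb Ms o f)) (subEmb ℓ k Mb Ms o ho x, i)
      = (DνΩ *ᵥ (mulH (ι := ι) (fun z => 1 - χv z) *ᵥ u)) (x, i)
        - (Dν₀ *ᵥ (G₀ *ᵥ extV ℓ k Mb Ms o g)) (subEmb ℓ k Mb Ms o ho x, i)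
        - (Dν₀ *ᵥ (G₀ *ᵥ extV ℓ k Mb Ms o f₃)) (subEmb ℓ k Mb Ms o ho x, i) := by
    rw [← hrestr, ← hrestr, ← hrestr]
    have := congrArg (fun w => (DνΩ *ᵥ w) (x, i)) hdec
    simp only [Matrix.mulVec_sub, Pi.sub_apply] at this
    exact this
  rw [hLHS]
  -- distance tools
  have hDx : ∀ x', P x' → D * (((ℓ + 1) ^ k : ℕ) : ℝ) ≤ supNorm (x.1 - x'.1) := fun x' hx' => by
    obtain ⟨μ, hμ⟩ := hD x' hx'; exact le_supNorm_of_coord ℓ k Ms x x' hμ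
  have hDbx : ∀ y : ↥(Box d ℓ k Mb), ¬ inSub ℓ k Mb Ms o y →
      Db * (((ℓ + 1) ^ k : ℕ) : ℝ) ≤ supNorm ((subEmb ℓ k Mb Ms o ho x).1 - y.1) := fun y hy => by
    obtain ⟨μ, hμ⟩ := hDb y hy; exact le_supNorm_of_coord ℓ k Mb _ y hμ
  have hDfx : ∀ x', P x' → ∀ y : ↥(Box d ℓ k Mb), ¬ inSub ℓ k Mb Ms o y →
      Df * (((ℓ + 1) ^ k : ℕ) : ℝ) ≤ supNorm ((subEmb ℓ k Mb Ms o ho x').1 - y.1) := fun x' hx' y hy => by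
    obtain ⟨μ, hμ⟩ := hDf x' hx' y hy; exact le_supNorm_of_coord ℓ k Mb _ y hμ
  set x' : ↥(Box d ℓ k Ms) := ⟨x.1 + e1 ν, hxν⟩ with hx'
  have hxx' : supNorm (x.1 - x'.1) ≤ 1 := supNorm_sub_le_one_of_mem_nbrs (mem_nbrs.2 ⟨ν, Or.inl rfl⟩)
  ---------------------------------------------------------------- T1'
  have hT1 : |(DνΩ *ᵥ (mulH (ι := ι) (fun z => 1 - χv z) *ᵥ u)) (x, i)| ≤ (cd + 8 * cv) * Real.exp (2 / K) * FF * φ := by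
    rw [hDνΩ, derivA_mulH_apply ℓ k F (e / ((ℓ + 1) ^ k : ℕ)) Ms _ (fun z => 1 - χv z) u ν x hxν i]
    -- a point of `Ω₀ ∖ Ω` within `2n` of `x`, when one of the two cutoff values is not `1`
    have hnear : χv x ≠ 1 ∨ χv x' ≠ 1 → ∃ y : ↥(Box d ℓ k Mb), ¬ inSub ℓ k Mb Ms o y ∧
        supNorm ((subEmb ℓ k Mb Ms o ho x).1 - y.1) ≤ 2 * (((ℓ + 1) ^ k : ℕ) : ℝ) := by
      rintro (h | h)
      · obtain ⟨y, hy, hd'⟩ := exists_out_of_chi_ne_one ℓ k Mb Ms o ho hn2 hMs x h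
        exact ⟨y, hy, by linarith only [hd', hnr.le]⟩
      · obtain ⟨y, hy, hd'⟩ := exists_out_of_chi_ne_one ℓ k Mb Ms o ho hn2 hMs x' h
        refine ⟨y, hy, ?_⟩
        have t1 := supNorm_sub_le_sub_add_sub (subEmb ℓ k Mb Ms o ho x).1 (subEmb ℓ k Mb Ms o ho x').1 y.1
        rw [supNorm_subEmb_sub_subEmb] at t1
        linarith only [t1, hd', hxx', hnr1]
    -- the common distance bookkeeping
    have hbook : (∃ y : ↥(Box d ℓ k Mb), ¬ inSub ℓ k Mb Ms o y ∧
        supNorm ((subEmb ℓ k Mb Ms o ho x).1 - y.1) ≤ 2 * (((ℓ + 1) ^ k : ℕ) : ℝ)) →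
        Db ≤ 2 ∧ ∀ x'', P x'' → max ((D + (Df - 2)) / 2) 0 * (((ℓ + 1) ^ k : ℕ) : ℝ) ≤ supNorm (x.1 - x''.1) := by
      rintro ⟨y, hy, hdy⟩
      refine ⟨?_, fun x'' hx'' => max_half_mul_le hnr.le (hDx x'' hx'') ?_ (supNorm_nonneg _)⟩
      · have := (hDbx y hy).trans hdy
        exact le_of_mul_le_mul_right (by linarith only [this]) hnr
      · have t1 := supNorm_sub_le_sub_add_sub (subEmb ℓ k Mb Ms o ho x'').1 (subEmb ℓ k Mb Ms o ho x).1 y.1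
        rw [supNorm_subEmb_sub_subEmb, supNorm_sub_comm x''.1] at t1
        have := hDfx x'' hx'' y hy
        rw [sub_mul]
        linarith only [t1, this, hdy]
    set D₁ : ℝ := max ((D + (Df - 2)) / 2) 0 with hD₁
    have hD₁0 : 0 ≤ D₁ := le_max_right _ _
    -- first term
    have hA : |(1 - χv x') * (DνΩ *ᵥ u) (x, i)| ≤ cd * Real.exp (2 / K) * FF * φ := by
      by_cases h1 : χv x' = 1
      · rw [h1, sub_self, zero_mul, abs_zero]; positivity
      obtain ⟨hDb2, hfarP⟩ := hbook (hnear (Or.inr h1))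
      have hD₁P : ∀ x'', P x'' → ∃ μ, D₁ ≤ |posR ℓ k Ms x μ - posR ℓ k Ms x'' μ| :=
        fun x'' hx'' => exists_coord_of_le_supNorm ℓ k Ms x x'' (hfarP x'' hx'')
      have hDu := DΩ ν x hxν P D₁ hD₁P f hfP φ hφ hf i
      have hexp : Real.exp (-(D₁ / Kd)) ≤ Real.exp (2 / K) * FF :=
        (hmonoD hD₁0).trans (exp_bookkeeping hKr (by
          have : (D + (Df - 2)) / 2 ≤ D₁ := le_max_left _ _
          linarith only [this, hDb2]))
      obtain ⟨h0, h1'⟩ := hχ01 x'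
      rw [abs_mul]
      calc |1 - χv x'| * |(DνΩ *ᵥ u) (x, i)| ≤ 1 * (cd * Real.exp (-(D₁ / Kd)) * φ) :=
            mul_le_mul (by rw [abs_of_nonneg (by linarith only [h1'])]; linarith only [h0]) hDu (abs_nonneg _)
              zero_le_one
        _ ≤ cd * (Real.exp (2 / K) * FF) * φ := by
            rw [one_mul]; exact mul_le_mul_of_nonneg_right (mul_le_mul_of_nonneg_left hexp hcd.le) hφ
        _ = cd * Real.exp (2 / K) * FF * φ := by ring
    -- second term
    have hB : |(((ℓ + 1) ^ k : ℕ) : ℝ) * ((1 - χv x') - (1 - χv x)) * u (x, i)|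
        ≤ 8 * cv * Real.exp (2 / K) * FF * φ := by
      by_cases h1 : χv x = χv x'
      · rw [h1, sub_self, mul_zero, zero_mul, abs_zero]; positivity
      have hne : χv x ≠ 1 ∨ χv x' ≠ 1 := by
        by_contra hc
        push Not at hc
        exact h1 (by rw [hc.1, hc.2])
      obtain ⟨hDb2, hfarP⟩ := hbook (hnear hne)
      have hD₁P : ∀ x'', P x'' → ∃ μ, D₁ ≤ |posR ℓ k Ms x μ - posR ℓ k Ms x'' μ| :=
        fun x'' hx'' => exists_coord_of_le_supNorm ℓ k Ms x x'' (hfarP x'' hx'')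
      have hux := VΩ x P D₁ hD₁P f hfP φ hφ hf i
      have hexp : Real.exp (-(D₁ / Kv)) ≤ Real.exp (2 / K) * FF :=
        (hmonoV hD₁0).trans (exp_bookkeeping hKr (by
          have : (D + (Df - 2)) / 2 ≤ D₁ := le_max_left _ _
          linarith only [this, hDb2]))
      have hgrad : |(((ℓ + 1) ^ k : ℕ) : ℝ) * ((1 - χv x') - (1 - χv x))| ≤ 8 := by
        have hmem : x' ∈ boxNbrs (fun j => (ℓ + 1) ^ k * Ms j) x := by
          unfold boxNbrs; simpa using (mem_nbrs.2 ⟨ν, Or.inl rfl⟩ : x'.1 ∈ nbrs x.1)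
        have := hsz.grad_le x x' hmem
        rw [show (1 - χv x') - (1 - χv x) = -(χv x' - χv x) by ring, mul_neg, abs_neg, abs_mul,
          abs_of_nonneg hnr.le]
        exact this
      rw [abs_mul]
      calc |(((ℓ + 1) ^ k : ℕ) : ℝ) * ((1 - χv x') - (1 - χv x))| * |u (x, i)|
          ≤ 8 * (cv * Real.exp (-(D₁ / Kv)) * φ) := mul_le_mul hgrad hux (abs_nonneg _) (by norm_num)
        _ ≤ 8 * (cv * (Real.exp (2 / K) * FF) * φ) := by
            refine mul_le_mul_of_nonneg_left ?_ (by norm_num)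
            exact mul_le_mul_of_nonneg_right (mul_le_mul_of_nonneg_left hexp hcv.le) hφ
        _ = 8 * cv * Real.exp (2 / K) * FF * φ := by ring
    refine (abs_add_le _ _).trans ?_
    have : cd * Real.exp (2 / K) * FF * φ + 8 * cv * Real.exp (2 / K) * FF * φ
        = (cd + 8 * cv) * Real.exp (2 / K) * FF * φ := by ring
    rw [← this]
    exact add_le_add hA hB
  ---------------------------------------------------------------- T3'
  have hT3 : |(Dν₀ *ᵥ (G₀ *ᵥ extV ℓ k Mb Ms o f₃)) (subEmb ℓ k Mb Ms o ho x, i)| ≤ cd * Real.exp (1 / K) * FF * φ := by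
    have hf₃v : ∀ q, f₃ q = (1 - χv q.1) * f q := fun q => mulH_mulVec_apply _ _ q
    have hxν' : (subEmb ℓ k Mb Ms o ho x).1 + e1 ν ∈ Box d ℓ k Mb := subEmb_add_e1_mem ℓ k Mb Ms o ho x ν hxν
    by_cases hP3 : ∃ a₀, P a₀ ∧ χv a₀ ≠ 1
    · obtain ⟨a₀, ha₀P, ha₀χ⟩ := hP3
      obtain ⟨y₀, hy₀, hd₀⟩ := exists_out_of_chi_ne_one ℓ k Mb Ms o ho hn2 hMs a₀ ha₀χ
      have hDf1 : Df ≤ 1 := by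
        have := (hDfx a₀ ha₀P y₀ hy₀).trans hd₀
        exact le_of_mul_le_mul_right (by linarith only [this]) hnr
      set D₃ : ℝ := max ((D + (Db - 1)) / 2) 0 with hD₃
      have hD₃0 : 0 ≤ D₃ := le_max_right _ _
      set P₃ : ↥(Box d ℓ k Mb) → Prop := fun y => ∃ a', subEmb ℓ k Mb Ms o ho a' = y ∧ P a' ∧ χv a' ≠ 1 with hP₃
      haveI hP₃d : DecidablePred P₃ := Classical.decPred P₃
      have hD₃P : ∀ y, P₃ y → ∃ μ, D₃ ≤ |posR ℓ k Mb (subEmb ℓ k Mb Ms o ho x) μ - posR ℓ k Mb y μ| := by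
        rintro y ⟨a', rfl, ha'P, ha'χ⟩
        obtain ⟨y', hy', hd'⟩ := exists_out_of_chi_ne_one ℓ k Mb Ms o ho hn2 hMs a' ha'χ
        refine exists_coord_of_le_supNorm ℓ k Mb _ _ (max_half_mul_le hnr.le ?_ ?_ (supNorm_nonneg _))
        · rw [supNorm_subEmb_sub_subEmb]; exact hDx a' ha'P
        · have t1 := supNorm_sub_le_sub_add_sub (subEmb ℓ k Mb Ms o ho x).1 (subEmb ℓ k Mb Ms o ho a').1 y'.1
          have := hDbx y' hy'
          rw [sub_mul, one_mul]
          linarith only [t1, this, hd']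
      have hsupp : ∀ q : ↥(Box d ℓ k Mb) × ι, ¬ P₃ q.1 → extV ℓ k Mb Ms o f₃ q = 0 := by
        intro q hq
        by_cases hqi : inSub ℓ k Mb Ms o q.1
        · obtain ⟨a', ha'⟩ := (inSub_iff ℓ k Mb Ms o ho _).mp hqi
          have hq' : q = (subEmb ℓ k Mb Ms o ho a', q.2) := Prod.ext ha'.symm rfl
          rw [hq', extV_subEmb, hf₃v]
          by_cases hPa : P a'
          · have hχa : χv a' = 1 := by
              by_contra hc; exact hq ⟨a', ha', hPa, hc⟩
            simp only [hχa, sub_self, zero_mul]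
          · rw [hfP (a', q.2) hPa, mul_zero]
        · exact extV_of_not_inSub ℓ k Mb Ms o f₃ hqi
      have hbd : ∀ q : ↥(Box d ℓ k Mb) × ι, |extV ℓ k Mb Ms o f₃ q| ≤ φ := by
        intro q
        by_cases hqi : inSub ℓ k Mb Ms o q.1
        · obtain ⟨a', ha'⟩ := (inSub_iff ℓ k Mb Ms o ho _).mp hqi
          have hq' : q = (subEmb ℓ k Mb Ms o ho a', q.2) := Prod.ext ha'.symm rfl
          rw [hq', extV_subEmb, hf₃v, abs_mul]
          obtain ⟨h0, h1⟩ := hχ01 a'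
          calc |1 - χv a'| * |f (a', q.2)| ≤ 1 * φ :=
                mul_le_mul (by rw [abs_of_nonneg (by linarith only [h1])]; linarith only [h0]) (hf _)
                  (abs_nonneg _) zero_le_one
            _ = φ := one_mul φ
        · rw [extV_of_not_inSub ℓ k Mb Ms o f₃ hqi, abs_zero]; exact hφ
      have h3 := DΩ₀ ν (subEmb ℓ k Mb Ms o ho x) hxν' P₃ D₃ hD₃P (extV ℓ k Mb Ms o f₃) hsupp φ hφ hbd i
      have hexp : Real.exp (-(D₃ / Kd)) ≤ Real.exp (1 / K) * FF :=
        (hmonoD hD₃0).trans (exp_bookkeeping hKr (by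
          have : (D + (Db - 1)) / 2 ≤ D₃ := le_max_left _ _
          linarith only [this, hDf1]))
      calc |(Dν₀ *ᵥ (G₀ *ᵥ extV ℓ k Mb Ms o f₃)) (subEmb ℓ k Mb Ms o ho x, i)| ≤ cd * Real.exp (-(D₃ / Kd)) * φ := h3
        _ ≤ cd * (Real.exp (1 / K) * FF) * φ :=
            mul_le_mul_of_nonneg_right (mul_le_mul_of_nonneg_left hexp hcd.le) hφ
        _ = cd * Real.exp (1 / K) * FF * φ := by ring
    · push Not at hP3
      have hf₃0 : f₃ = 0 := by
        funext q
        rw [hf₃v]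
        by_cases hPq : P q.1
        · rw [hP3 q.1 hPq, sub_self, zero_mul]; rfl
        · rw [hfP q hPq, mul_zero]; rfl
      have hE0 : extV ℓ k Mb Ms o f₃ = 0 := by
        funext q; rw [hf₃0]; simp [extV]
      rw [hE0, Matrix.mulVec_zero, Matrix.mulVec_zero, Pi.zero_apply, abs_zero]
      positivity
  ---------------------------------------------------------------- T2'
  have hT2 : |(Dν₀ *ᵥ (G₀ *ᵥ extV ℓ k Mb Ms o g)) (subEmb ℓ k Mb Ms o ho x, i)|
      ≤ cd * CK * Real.exp (4 / K) / (1 - r) * FF * φ := by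
    have hxν' : (subEmb ℓ k Mb Ms o ho x).1 + e1 ν ∈ Box d ℓ k Mb := subEmb_add_e1_mem ℓ k Mb Ms o ho x ν hxν
    -- the source facts
    have hval : ∀ (a'' : ↥(Box d ℓ k Ms)) (D' : ℝ), 0 ≤ D' →
        (∀ x'', P x'' → D' * (((ℓ + 1) ^ k : ℕ) : ℝ) ≤ supNorm (a''.1 - x''.1)) →
        ∀ j, |u (a'', j)| ≤ cv * Real.exp (-(D' / K)) * φ := by
      intro a'' D' hD'0 hD' j
      have := VΩ a'' P D' (fun x'' hx'' => exists_coord_of_le_supNorm ℓ k Ms a'' x'' (hD' x'' hx'')) f hfP φ hφ hf j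
      exact this.trans (mul_le_mul_of_nonneg_right (mul_le_mul_of_nonneg_left (hmonoV hD'0) hcv.le) hφ)
    have hder : ∀ (a'' : ↥(Box d ℓ k Ms)) (μ : Fin (d + 1)), a''.1 + e1 μ ∈ Box d ℓ k Ms → ∀ (D' : ℝ), 0 ≤ D' →
        (∀ x'', P x'' → D' * (((ℓ + 1) ^ k : ℕ) : ℝ) ≤ supNorm (a''.1 - x''.1)) →
        ∀ j, |(derivA d F (e / ((ℓ + 1) ^ k : ℕ)) ℓ k Ms (fun u v : ↥(Box d ℓ k Ms) => compField Ac' u.1 v.1) μ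
          *ᵥ u) (a'', j)| ≤ cd * Real.exp (-(D' / K)) * φ := by
      intro a'' μ hμ D' hD'0 hD' j
      have := DΩ μ a'' hμ P D' (fun x'' hx'' => exists_coord_of_le_supNorm ℓ k Ms a'' x'' (hD' x'' hx''))
        f hfP φ hφ hf j
      exact this.trans (mul_le_mul_of_nonneg_right (mul_le_mul_of_nonneg_left (hmonoD hD'0) hcd.le) hφ)
    have hsrc := source_facts ℓ k Mb Ms o F (e / ((ℓ + 1) ^ k : ℕ)) ho hℓ hk hn hMs ha ha1 ha2 m2 Ac' u x P
      hcv.le hcd.le hφ hDx hDbx hDfx hval hder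
    -- the row bound of the functional `src ↦ (D_νG₀ src)(x)`
    set R : (↥(Box d ℓ k Mb) × ι → ℝ) → ℝ := fun src => (Dν₀ *ᵥ (G₀ *ᵥ src)) (subEmb ℓ k Mb Ms o ho x, i) with hR
    have hRsum : ∀ (s : Finset ℕ) (v : ℕ → ↥(Box d ℓ k Mb) × ι → ℝ), R (∑ m ∈ s, v m) = ∑ m ∈ s, R (v m) := by
      intro s v
      simp only [hR, Matrix.mulVec_sum, Finset.sum_apply]
    have hRrow : ∀ (Pm : ↥(Box d ℓ k Mb) → Prop) [DecidablePred Pm] (m : ℕ),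
        (∀ y, Pm y → (m : ℝ) * (((ℓ + 1) ^ k : ℕ) : ℝ) ≤ supNorm ((subEmb ℓ k Mb Ms o ho x).1 - y.1)) →
        ∀ src : ↥(Box d ℓ k Mb) × ι → ℝ, (∀ q, ¬ Pm q.1 → src q = 0) → ∀ φ' : ℝ, 0 ≤ φ' →
        (∀ q, |src q| ≤ φ') → |R src| ≤ cd * Real.exp (-((m : ℝ) / K)) * φ' := by
      intro Pm _ m hPm src hsupp φ' hφ' hbd
      have := DΩ₀ ν (subEmb ℓ k Mb Ms o ho x) hxν' Pm (m : ℝ)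
        (fun y hy => exists_coord_of_le_supNorm ℓ k Mb _ y (hPm y hy)) src hsupp φ' hφ' hbd i
      exact this.trans (mul_le_mul_of_nonneg_right
        (mul_le_mul_of_nonneg_left (hmonoD (Nat.cast_nonneg m)) hcd.le) hφ')
    have hann := annular_bound ℓ k Mb Ms o ho x g R hRsum hKr hcd.le hCK0 hφ
      (fun m => max (max (D - m - 2) (Df - 3)) 0)
      (fun m => by
        show ((D - (m : ℝ) - 2) + (Df - 3)) / 2 ≤ max (max (D - (m : ℝ) - 2) (Df - 3)) 0
        have h1 : D - m - 2 ≤ max (max (D - (m : ℝ) - 2) (Df - 3)) 0 := (le_max_left _ _).trans (le_max_left _ _)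
        have h2 : Df - 3 ≤ max (max (D - (m : ℝ) - 2) (Df - 3)) 0 := (le_max_right _ _).trans (le_max_left _ _)
        linarith only [h1, h2])
      hRrow hsrc
    simpa only [hR, hr] using hann
  ---------------------------------------------------------------- total
  have hsum : |(DνΩ *ᵥ (mulH (ι := ι) (fun z => 1 - χv z) *ᵥ u)) (x, i)
      - (Dν₀ *ᵥ (G₀ *ᵥ extV ℓ k Mb Ms o g)) (subEmb ℓ k Mb Ms o ho x, i)
      - (Dν₀ *ᵥ (G₀ *ᵥ extV ℓ k Mb Ms o f₃)) (subEmb ℓ k Mb Ms o ho x, i)|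
      ≤ (cd + 8 * cv) * Real.exp (2 / K) * FF * φ + cd * CK * Real.exp (4 / K) / (1 - r) * FF * φ
        + cd * Real.exp (1 / K) * FF * φ := by
    refine (abs_sub _ _).trans (add_le_add ((abs_sub _ _).trans (add_le_add hT1 hT2)) hT3)
  refine hsum.trans ?_
  have : (cd + 8 * cv) * Real.exp (2 / K) * FF * φ + cd * CK * Real.exp (4 / K) / (1 - r) * FF * φ
      + cd * Real.exp (1 / K) * FF * φ
      = ((cd + 8 * cv) * Real.exp (2 / K) + cd * Real.exp (1 / K) + cd * CK * Real.exp (4 / K) / (1 - r)) * FF * φ := by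
    ring
  rw [this, hFF]
  refine mul_le_mul_of_nonneg_right (mul_le_mul_of_nonneg_right ?_ hFF0.le) hφ
  rw [hc₁]
  exact le_add_of_nonneg_right zero_le_one

/-! ## §3. The Hölder member of (1.11)·(1.12), `K` before `α`, no collar -/

set_option maxHeartbeats 800000 in
/-- (K-before-α form, G-B4-p17-03: quantifiers `∃ K ∀ α ∃ c_H`; the modulus `K` is the product of the members' α-free moduli.)
**THEOREM p. 573, THE `δG` CLAUSE (1.11)–(1.12), HÖLDER MEMBER, ON EVERY NESTED PAIR OF BOXES, ALL PAIRS `x ≠ x′`,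
WITH ONLY «e SUFFICIENTLY SMALL», NO COLLAR**.  For `0 ≤ α < 1` there are `K` (`16 ≤ K`, `4 ∣ K`) and `c_H > 0` (depending on
`d`, `ℓ`, `N`, `α`, the flow and the windows only) such that for every `(c, β)` (`β > 0`) there is `e₁ > 0` with: for
every scale `k ≥ 1`, `a ∈ [a₋,a₊]`, `m² ∈ [0,m²₊]`, every pair of boxes `Ω = n·o + Π[0,nMs) ⊂ Ω₀ = Π[0,nMb)` with
unit sides multiples of `K`, every component field `A_c`, (1.7)-regular on `Ω₀` (NO collar hypothesis),
every `0 < e ≤ e₁` (coupling `e/n`), every direction `ν` and sites `x ≠ x′` with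
`⟨x,x+ηe_ν⟩, ⟨x′,x′+ηe_ν⟩ ⊂ Ω`, every nearest-neighbour chain `Γ` of `Ω` from `x` to `x′` with `|Γ| ≤ (d+1)|x′−x|_∞`
inside the `|x′−x|_∞`-ball about `x`, every source `f` on `Ω` supported in `P` with `|f| ≤ φ`, and all
`D, D_b, D_f ≥ 0` below the unit-lattice sup-distances from both `x, x′` to `P`, from both `x, x′` to `Ω₀ ∖ Ω`, and
from `P` to `Ω₀ ∖ Ω`: with `δ = G_k(Ω,A|Ω)f − (G_k(Ω₀,A)Ef)|Ω`,
`(n/|x′−x|_∞)^α·|U(A(Γ))(D^η_{A,ν}δ)(x′) − (D^η_{A,ν}δ)(x)|_i ≤ c_H·exp(−(D + D_b + D_f)/(2K))·φ`.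
[cite: Balaban1983RegularityDecay, Theorem (1.9), (1.11)–(1.12) p.573; p.579] -/
theorem thm112_holder_box_noCollar (F : OrthFlow ι) {ℓ₁ : ℝ} (hℓ₁ : 0 ≤ ℓ₁)
    (hLip : ∀ t (v : ι → ℝ), ((F.U t - 1) *ᵥ v) ⬝ᵥ ((F.U t - 1) *ᵥ v) ≤ (ℓ₁ * t) ^ 2 * (v ⬝ᵥ v))
    (d ℓ : ℕ) (hd : 1 ≤ d) (hℓ : 1 ≤ ℓ) (amin aplus m2plus : ℝ) (ha : 0 < amin) :
    ∃ K : ℕ, 16 ≤ K ∧ 4 ∣ K ∧ ∀ (α : ℝ), 0 ≤ α → α < 1 → ∃ cH : ℝ, 0 < cH ∧ ∀ (creg β : ℝ), 0 ≤ creg → 0 < β →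
      ∃ e₁ : ℝ, 0 < e₁ ∧ ∀ (k : ℕ), 1 ≤ k → ∀ (hn : 1 ≤ (ℓ + 1) ^ k) (a m2 : ℝ),
      amin ≤ a → a ≤ aplus → 0 ≤ m2 → m2 ≤ m2plus →
      ∀ (Mb Ms o : Fin (d + 1) → ℕ) (ho : ∀ i, o i + Ms i ≤ Mb i), (∀ i, 1 ≤ Ms i) → (∀ μ, K ∣ Mb μ) →
        (∀ μ, K ∣ Ms μ) →
      ∀ (Ac : (Fin (d + 1) → ℤ) → Fin (d + 1) → ℝ) (e : ℝ), 0 < e → e ≤ e₁ →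
        (∀ x ∈ Box d ℓ k Mb, ∀ μ ν : Fin (d + 1),
          |Ac (x + e1 μ) ν - Ac x ν| ≤ creg * e ^ (β - 1) / ((ℓ + 1) ^ k : ℕ)) →
      ∀ (ν : Fin (d + 1)) (x x' : ↥(Box d ℓ k Ms)), x.1 + e1 ν ∈ Box d ℓ k Ms → x'.1 + e1 ν ∈ Box d ℓ k Ms →
        x'.1 ≠ x.1 →
      ∀ (l : List ↥(Box d ℓ k Ms)), IsNNChain x l → pathEnd x l = x' →
        (l.length : ℝ) ≤ ((d : ℝ) + 1) * supNorm (x'.1 - x.1) → (∀ z ∈ l, supNorm (z.1 - x.1) ≤ supNorm (x'.1 - x.1)) →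
      ∀ (P : ↥(Box d ℓ k Ms) → Prop) [DecidablePred P] (D Db Df : ℝ),
        0 ≤ D → 0 ≤ Db → 0 ≤ Df →
        (∀ x'', P x'' → ∃ μ, D ≤ |posR ℓ k Ms x μ - posR ℓ k Ms x'' μ|) →
        (∀ x'', P x'' → ∃ μ, D ≤ |posR ℓ k Ms x' μ - posR ℓ k Ms x'' μ|) →
        (∀ y : ↥(Box d ℓ k Mb), ¬ inSub ℓ k Mb Ms o y →
          ∃ μ, Db ≤ |posR ℓ k Mb (subEmb ℓ k Mb Ms o ho x) μ - posR ℓ k Mb y μ|) →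
        (∀ y : ↥(Box d ℓ k Mb), ¬ inSub ℓ k Mb Ms o y →
          ∃ μ, Db ≤ |posR ℓ k Mb (subEmb ℓ k Mb Ms o ho x') μ - posR ℓ k Mb y μ|) →
        (∀ x'', P x'' → ∀ y : ↥(Box d ℓ k Mb), ¬ inSub ℓ k Mb Ms o y →
          ∃ μ, Df ≤ |posR ℓ k Mb (subEmb ℓ k Mb Ms o ho x'') μ - posR ℓ k Mb y μ|) →
      ∀ (f : ↥(Box d ℓ k Ms) × ι → ℝ), (∀ p, ¬ P p.1 → f p = 0) → ∀ (φ : ℝ), 0 ≤ φ → (∀ p, |f p| ≤ φ) →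
      ∀ i : ι,
        ((((ℓ + 1) ^ k : ℕ) : ℝ) / supNorm (x'.1 - x.1)) ^ α *
          |(transport (fieldLink F (e / ((ℓ + 1) ^ k : ℕ))
                (fun u v : ↥(Box d ℓ k Ms) =>
                  compField (fun w => Ac (w + fun i => (((ℓ + 1) ^ k : ℕ) : ℤ) * (o i : ℤ))) u.1 v.1)) x l
              *ᵥ fld (derivA d F (e / ((ℓ + 1) ^ k : ℕ)) ℓ k Ms
                  (fun u v : ↥(Box d ℓ k Ms) =>
                    compField (fun w => Ac (w + fun i => (((ℓ + 1) ^ k : ℕ) : ℤ) * (o i : ℤ))) u.1 v.1) ν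
                *ᵥ (greenA d F (e / ((ℓ + 1) ^ k : ℕ)) ℓ k a m2 Ms (baseEmb hn Ms) (stairContour hn Ms)
                      (fun u v : ↥(Box d ℓ k Ms) =>
                        compField (fun w => Ac (w + fun i => (((ℓ + 1) ^ k : ℕ) : ℤ) * (o i : ℤ))) u.1 v.1) *ᵥ f
                    - restrV ℓ k Mb Ms o ho
                      (greenA d F (e / ((ℓ + 1) ^ k : ℕ)) ℓ k a m2 Mb (baseEmb hn Mb) (stairContour hn Mb)
                        (fun u v : ↥(Box d ℓ k Mb) => compField Ac u.1 v.1) *ᵥ extV ℓ k Mb Ms o f))) x'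
            - fld (derivA d F (e / ((ℓ + 1) ^ k : ℕ)) ℓ k Ms
                  (fun u v : ↥(Box d ℓ k Ms) =>
                    compField (fun w => Ac (w + fun i => (((ℓ + 1) ^ k : ℕ) : ℤ) * (o i : ℤ))) u.1 v.1) ν
                *ᵥ (greenA d F (e / ((ℓ + 1) ^ k : ℕ)) ℓ k a m2 Ms (baseEmb hn Ms) (stairContour hn Ms)
                      (fun u v : ↥(Box d ℓ k Ms) =>
                        compField (fun w => Ac (w + fun i => (((ℓ + 1) ^ k : ℕ) : ℤ) * (o i : ℤ))) u.1 v.1) *ᵥ f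
                    - restrV ℓ k Mb Ms o ho
                      (greenA d F (e / ((ℓ + 1) ^ k : ℕ)) ℓ k a m2 Mb (baseEmb hn Mb) (stairContour hn Mb)
                        (fun u v : ↥(Box d ℓ k Mb) => compField Ac u.1 v.1) *ᵥ extV ℓ k Mb Ms o f))) x) i|
          ≤ cH * Real.exp (-((D + Db + Df) / (2 * K))) * φ := by
  classical
  obtain ⟨K₁, hK₁, h4₁, c₁, hc₁, H₁⟩ := thm112_deriv_box_noCollar F hℓ₁ hLip d ℓ hd hℓ amin aplus m2plus ha
  obtain ⟨K₂, hK₂, -, HU₂⟩ := thm19_holder_box_noCollar_all F hℓ₁ hLip d ℓ hd hℓ amin aplus m2plus ha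
  obtain ⟨K₃, hK₃, -, cv, hcv, H₃⟩ := thm110_value_box_noCollar F hℓ₁ hLip d ℓ hd hℓ amin aplus m2plus ha
  obtain ⟨K₄, hK₄, -, cd, hcd, H₄⟩ := thm110_deriv_box_noCollar F hℓ₁ hLip d ℓ hd hℓ amin aplus m2plus ha
  set K : ℕ := K₁ * K₂ * (K₃ * K₄) with hK
  have hK₃₄ : 1 ≤ K₃ * K₄ := Nat.one_le_iff_ne_zero.mpr (by positivity)
  have hK₁₂ : 1 ≤ K₁ * K₂ := Nat.one_le_iff_ne_zero.mpr (by positivity)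
  have hK₁K : K₁ ≤ K := by rw [hK]; nlinarith
  have hK₂K : K₂ ≤ K := by rw [hK]; nlinarith
  have hK₃K : K₃ ≤ K := by rw [hK]; nlinarith
  have hK₄K : K₄ ≤ K := by rw [hK]; nlinarith
  have hK16 : 16 ≤ K := hK₁.trans hK₁K
  have h4 : 4 ∣ K := by rw [hK, mul_assoc]; exact dvd_mul_of_dvd_left h4₁ _
  have hKr : (0 : ℝ) < K := by exact_mod_cast lt_of_lt_of_le (by norm_num) hK16
  have hmono : ∀ K' : ℕ, 1 ≤ K' → K' ≤ K → ∀ {D' : ℝ}, 0 ≤ D' → Real.exp (-(D' / K')) ≤ Real.exp (-(D' / K)) := by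
    intro K' hK'1 hK'K D' hD'
    have hK'r : (0 : ℝ) < K' := by exact_mod_cast hK'1
    exact Real.exp_le_exp.mpr (neg_le_neg (div_le_div_of_nonneg_left hD' hK'r (by exact_mod_cast hK'K)))
  have hK₁1 : 1 ≤ K₁ := le_trans (by norm_num) hK₁
  have hK₂1 : 1 ≤ K₂ := le_trans (by norm_num) hK₂
  have hK₃1 : 1 ≤ K₃ := le_trans (by norm_num) hK₃
  have hK₄1 : 1 ≤ K₄ := le_trans (by norm_num) hK₄
  -- `e^{−D'/(2K₁)} ≤ e^{−D'/(2K)}`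
  have hmono2 : ∀ {D' : ℝ}, 0 ≤ D' → Real.exp (-(D' / (2 * K₁))) ≤ Real.exp (-(D' / (2 * K))) := by
    intro D' hD'
    have hK₁r : (0 : ℝ) < K₁ := by exact_mod_cast hK₁1
    have : (2 : ℝ) * K₁ ≤ 2 * K := by
      have : (K₁ : ℝ) ≤ K := by exact_mod_cast hK₁K
      linarith only [this]
    exact Real.exp_le_exp.mpr (neg_le_neg (div_le_div_of_nonneg_left hD' (by positivity) this))
  refine ⟨K, hK16, h4, fun α hα0 hα1 => ?_⟩
  obtain ⟨c₂, hc₂, H₂⟩ := HU₂ α hα0 hα1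
  -- the constants
  set CK : ℝ := |Real.sqrt (Fintype.card ι) * (16 * ((d : ℝ) + 1) * cd + (64 * ((d : ℝ) + 1) + 2 * aplus) * cv)|
    with hCK
  have hCK0 : 0 ≤ CK := abs_nonneg _
  set r : ℝ := Real.exp (-(1 / (2 * K))) with hr
  have hr1 : r < 1 := Real.exp_lt_one_iff.mpr (by
    have : 0 < 1 / (2 * (K : ℝ)) := by positivity
    linarith only [this])
  have h1r : 0 < 1 - r := by linarith only [hr1]
  set cT1 : ℝ := (c₂ + 8 * ((d : ℝ) + 1) * cd + 8 * ((d : ℝ) + 1) * Real.sqrt (Fintype.card ι) * cd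
      + 128 * ((d : ℝ) + 1) * cv) * Real.exp (4 / K) with hcT1
  set cH : ℝ := ((Fintype.card ι : ℝ) + 1) * c₁ + cT1 + c₂ * Real.exp (1 / K) * CK * Real.exp (4 / K) / (1 - r)
      + c₂ * Real.exp (2 / K) + 1 with hcH
  have hcH0 : 0 < cH := by positivity
  refine ⟨cH, hcH0, fun creg β' hcreg hβ => ?_⟩
  obtain ⟨e₁', he₁', H₁'⟩ := H₁ creg β' hcreg hβ
  obtain ⟨e₂, he₂, H₂'⟩ := H₂ creg β' hcreg hβ
  obtain ⟨e₃, he₃, H₃'⟩ := H₃ creg β' hcreg hβ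
  obtain ⟨e₄, he₄, H₄'⟩ := H₄ creg β' hcreg hβ
  refine ⟨min (min e₁' e₂) (min e₃ e₄), lt_min (lt_min he₁' he₂) (lt_min he₃ he₄), ?_⟩
  intro k hk hn a m2 ha1 ha2 hm1 hm2 Mb Ms o ho hMs hKMb hKMs Ac e he hle h17 ν x x' hxν hx'ν hne l hl hlend
    hlen hlnear P _ D Db Df hD0 hDb0 hDf0 hD hD' hDb hDb' hDf f hfP φ hφ hf i
  -- scale facts
  have hn2 : 2 ≤ (ℓ + 1) ^ k := two_le_pow hℓ hk
  have hnr : (0 : ℝ) < (((ℓ + 1) ^ k : ℕ) : ℝ) := by exact_mod_cast hn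
  have hnr1 : (1 : ℝ) ≤ (((ℓ + 1) ^ k : ℕ) : ℝ) := by exact_mod_cast hn
  have hMb : ∀ i, 1 ≤ Mb i := fun i => le_trans (le_trans (hMs i) (Nat.le_add_left _ _)) (ho i)
  have ha' : 0 < a := lt_of_lt_of_le ha ha1
  have hle₁ : e ≤ e₁' := hle.trans ((min_le_left _ _).trans (min_le_left _ _))
  have hle₂ : e ≤ e₂ := hle.trans ((min_le_left _ _).trans (min_le_right _ _))
  have hle₃ : e ≤ e₃ := hle.trans ((min_le_right _ _).trans (min_le_left _ _))
  have hle₄ : e ≤ e₄ := hle.trans ((min_le_right _ _).trans (min_le_right _ _))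
  have hdvd : ∀ K' : ℕ, K' ∣ K → (∀ μ, K' ∣ Mb μ) ∧ (∀ μ, K' ∣ Ms μ) := fun K' hK' =>
    ⟨fun μ => hK'.trans (hKMb μ), fun μ => hK'.trans (hKMs μ)⟩
  have hd₁ : K₁ ∣ K := by rw [hK, mul_assoc]; exact dvd_mul_right _ _
  have hd₂ : K₂ ∣ K := by rw [hK, mul_comm K₁, mul_assoc]; exact dvd_mul_right _ _
  have hd₃ : K₃ ∣ K := by rw [hK, mul_comm, mul_assoc]; exact dvd_mul_right _ _
  have hd₄ : K₄ ∣ K := by rw [hK, mul_comm, mul_comm K₃, mul_assoc]; exact dvd_mul_right _ _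
  -- the translated component field of `Ω`
  set t : Fin (d + 1) → ℤ := fun i => (((ℓ + 1) ^ k : ℕ) : ℤ) * (o i : ℤ) with ht
  set Ac' : (Fin (d + 1) → ℤ) → Fin (d + 1) → ℝ := fun w => Ac (w + t) with hAc'
  have hsubF : subField ℓ k Mb Ms o ho (fun u v : ↥(Box d ℓ k Mb) => compField Ac u.1 v.1)
      = fun u v : ↥(Box d ℓ k Ms) => compField Ac' u.1 v.1 := by
    funext a' b'
    show compField Ac (subEmb ℓ k Mb Ms o ho a').1 (subEmb ℓ k Mb Ms o ho b').1 = compField Ac' a'.1 b'.1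
    have h1 : (subEmb ℓ k Mb Ms o ho a').1 = a'.1 + t := by funext j; simp [subEmb, ht]
    have h2 : (subEmb ℓ k Mb Ms o ho b').1 = b'.1 + t := by funext j; simp [subEmb, ht]
    rw [h1, h2, compField_add]
  have hmemT : ∀ w ∈ Box d ℓ k Ms, w + t ∈ Box d ℓ k Mb := fun w hw =>
    B4SubBoxCarrier.shift_mem_Box ℓ k Mb Ms o ho ⟨w, hw⟩
  have h17' : ∀ w ∈ Box d ℓ k Ms, ∀ μ ν : Fin (d + 1),
      |Ac' (w + e1 μ) ν - Ac' w ν| ≤ creg * e ^ (β' - 1) / ((ℓ + 1) ^ k : ℕ) := by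
    intro w hw μ ν
    have := h17 (w + t) (hmemT w hw) μ ν
    simp only [hAc']
    rw [add_right_comm]
    exact this
  -- abbreviations
  set κ : ℝ := e / ((ℓ + 1) ^ k : ℕ) with hκ
  set AΩ : ↥(Box d ℓ k Ms) → ↥(Box d ℓ k Ms) → ℝ := fun u v => compField Ac' u.1 v.1 with hAΩ
  set A₀ : ↥(Box d ℓ k Mb) → ↥(Box d ℓ k Mb) → ℝ := fun u v => compField Ac u.1 v.1 with hA₀
  set GΩ := greenA d F κ ℓ k a m2 Ms (baseEmb hn Ms) (stairContour hn Ms) AΩ with hGΩ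
  set G₀ := greenA d F κ ℓ k a m2 Mb (baseEmb hn Mb) (stairContour hn Mb) A₀ with hG₀
  set DνΩ := derivA d F κ ℓ k Ms AΩ ν with hDνΩ
  set Dν₀ := derivA d F κ ℓ k Mb A₀ ν with hDν₀
  set u := GΩ *ᵥ f with hu
  set δv := u - restrV ℓ k Mb Ms o ho (G₀ *ᵥ extV ℓ k Mb Ms o f) with hδv
  set T := transport (fieldLink F κ AΩ) x l with hT
  set ex := subEmb ℓ k Mb Ms o ho x with hex
  set ex' := subEmb ℓ k Mb Ms o ho x' with hex'
  set sN : ℝ := supNorm (x'.1 - x.1) with hsN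
  set wt : ℝ := ((((ℓ + 1) ^ k : ℕ) : ℝ) / sN) ^ α with hwt
  set FF : ℝ := Real.exp (-((D + Db + Df) / (2 * K))) with hFF
  have hFF0 : 0 < FF := Real.exp_pos _
  have hs1 : 1 ≤ sN := one_le_supNorm_of_ne hne
  have hs0 : 0 < sN := lt_of_lt_of_le one_pos hs1
  have hwt0 : 0 ≤ wt := Real.rpow_nonneg (div_nonneg hnr.le hs0.le) α
  have hAas : ∀ u' v' : ↥(Box d ℓ k Ms), AΩ v' u' = -AΩ u' v' := fun u' v' =>
    B4Lemma21Region.compField_rev Ac' u'.1 v'.1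
  -- the members used (instantiated after the abbreviations: no abstraction pass over them)
  have D112 := H₁' k hk hn a m2 ha1 ha2 hm1 hm2 Mb Ms o ho hMs (hdvd K₁ hd₁).1 (hdvd K₁ hd₁).2 Ac e he hle₁ h17
  have HΩ := H₂' k hk hn a m2 ha1 ha2 hm1 hm2 Ms hMs (hdvd K₂ hd₂).2 Ac' e he hle₂ h17'
  have HΩ₀ := H₂' k hk hn a m2 ha1 ha2 hm1 hm2 Mb hMb (hdvd K₂ hd₂).1 Ac e he hle₂ h17
  have VΩ := H₃' k hk hn a m2 ha1 ha2 hm1 hm2 Ms hMs (hdvd K₃ hd₃).2 Ac' e he hle₃ h17'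
  have DΩ := H₄' k hk hn a m2 ha1 ha2 hm1 hm2 Ms hMs (hdvd K₄ hd₄).2 Ac' e he hle₄ h17'
  clear H₁' H₂' H₃' H₄'
  -- image chain facts
  have hexne : ex'.1 ≠ ex.1 := fun h => hne (congrArg Subtype.val (subEmb_injective ℓ k Mb Ms o ho (Subtype.ext h)))
  have hsNe : supNorm (ex'.1 - ex.1) = sN := supNorm_subEmb_sub_subEmb ℓ k Mb Ms o ho x' x
  have hTe : transport (fieldLink F κ A₀) ex (l.map (subEmb ℓ k Mb Ms o ho)) = T := by
    rw [hT, hex, transport_map]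
    congr 1
    funext u' v'
    show fieldLink F κ A₀ (subEmb ℓ k Mb Ms o ho u') (subEmb ℓ k Mb Ms o ho v') = fieldLink F κ AΩ u' v'
    simp only [fieldLink]
    congr 2
    have := congrFun (congrFun hsubF u') v'
    exact this
  have hle' : IsNNChain ex (l.map (subEmb ℓ k Mb Ms o ho)) := isNNChain_map_subEmb ℓ k Mb Ms o ho x l hl
  have hlend' : pathEnd ex (l.map (subEmb ℓ k Mb Ms o ho)) = ex' := by rw [hex, pathEnd_map, hlend]
  have hlen' : ((l.map (subEmb ℓ k Mb Ms o ho)).length : ℝ) ≤ ((d : ℝ) + 1) * supNorm (ex'.1 - ex.1) := by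
    rw [List.length_map, hsNe]; exact hlen
  have hlnear' : ∀ z ∈ l.map (subEmb ℓ k Mb Ms o ho), supNorm (z.1 - ex.1) ≤ supNorm (ex'.1 - ex.1) := by
    intro z hz
    obtain ⟨w, hw, rfl⟩ := List.mem_map.1 hz
    rw [hsNe, hex, supNorm_subEmb_sub_subEmb]
    exact hlnear w hw
  -- the derivative member of `δG` at a site `z ∈ {x, x′}` in vector form
  have hδpt : ∀ (z : ↥(Box d ℓ k Ms)) (hz : z.1 + e1 ν ∈ Box d ℓ k Ms) (j : ι),
      fld (DνΩ *ᵥ δv) z j = (DνΩ *ᵥ u) (z, j) - (Dν₀ *ᵥ (G₀ *ᵥ extV ℓ k Mb Ms o f)) (subEmb ℓ k Mb Ms o ho z, j) := by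
    intro z hz j
    have h1 := derivA_restrV_apply ℓ k Mb Ms o F κ ho A₀ (G₀ *ᵥ extV ℓ k Mb Ms o f) ν z hz j
    rw [hsubF] at h1
    have h2 : fld (DνΩ *ᵥ δv) z j
        = (DνΩ *ᵥ u) (z, j) - (DνΩ *ᵥ restrV ℓ k Mb Ms o ho (G₀ *ᵥ extV ℓ k Mb Ms o f)) (z, j) := by
      rw [fld_apply, hδv, Matrix.mulVec_sub, Pi.sub_apply]
    rw [h2]
    exact congrArg (fun t : ℝ => (DνΩ *ᵥ u) (z, j) - t) h1
  -- distance tools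
  have hDx : ∀ x'', P x'' → D * (((ℓ + 1) ^ k : ℕ) : ℝ) ≤ supNorm (x.1 - x''.1) := fun x'' hx'' => by
    obtain ⟨μ, hμ⟩ := hD x'' hx''; exact le_supNorm_of_coord ℓ k Ms x x'' hμ
  have hDbx : ∀ y : ↥(Box d ℓ k Mb), ¬ inSub ℓ k Mb Ms o y →
      Db * (((ℓ + 1) ^ k : ℕ) : ℝ) ≤ supNorm (ex.1 - y.1) := fun y hy => by
    obtain ⟨μ, hμ⟩ := hDb y hy; exact le_supNorm_of_coord ℓ k Mb _ y hμ
  have hDfx : ∀ x'', P x'' → ∀ y : ↥(Box d ℓ k Mb), ¬ inSub ℓ k Mb Ms o y →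
      Df * (((ℓ + 1) ^ k : ℕ) : ℝ) ≤ supNorm ((subEmb ℓ k Mb Ms o ho x'').1 - y.1) := fun x'' hx'' y hy => by
    obtain ⟨μ, hμ⟩ := hDf x'' hx'' y hy; exact le_supNorm_of_coord ℓ k Mb _ y hμ
  ---------------------------------------------------------------- far pairs
  by_cases hfar : (((ℓ + 1) ^ k : ℕ) : ℝ) < sN
  · have hw1 : wt ≤ 1 := holderWeight_le_one hs0 hfar.le hα0
    have hb0 : 0 ≤ c₁ * Real.exp (-((D + Db + Df) / (2 * K₁))) * φ := by positivity
    have hx1 := D112 ν x hxν P D Db Df hD0 hDb0 hDf0 hD hDb hDf f hfP φ hφ hf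
    have hx2 := D112 ν x' hx'ν P D Db Df hD0 hDb0 hDf0 hD' hDb' hDf f hfP φ hφ hf
    have hV : ∀ j, |fld (DνΩ *ᵥ δv) x j| ≤ c₁ * Real.exp (-((D + Db + Df) / (2 * K₁))) * φ := fun j => by
      rw [hδpt x hxν j]; exact hx1 j
    have hV' : ∀ j, |fld (DνΩ *ᵥ δv) x' j| ≤ c₁ * Real.exp (-((D + Db + Df) / (2 * K₁))) * φ := fun j => by
      rw [hδpt x' hx'ν j]; exact hx2 j
    have hU : |(T *ᵥ fld (DνΩ *ᵥ δv) x') i| ≤ (Fintype.card ι : ℝ) * (c₁ * Real.exp (-((D + Db + Df) / (2 * K₁))) * φ) := by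
      rw [hT, transport_fieldLink]
      exact abs_U_mulVec_apply_le F _ _ hb0 hV' i
    have hdiff : |(T *ᵥ fld (DνΩ *ᵥ δv) x' - fld (DνΩ *ᵥ δv) x) i|
        ≤ ((Fintype.card ι : ℝ) + 1) * (c₁ * Real.exp (-((D + Db + Df) / (2 * K₁))) * φ) := by
      rw [Pi.sub_apply]
      refine (abs_sub _ _).trans ?_
      have := hV i
      linarith only [hU, this]
    calc wt * |(T *ᵥ fld (DνΩ *ᵥ δv) x' - fld (DνΩ *ᵥ δv) x) i|
        ≤ 1 * (((Fintype.card ι : ℝ) + 1) * (c₁ * Real.exp (-((D + Db + Df) / (2 * K₁))) * φ)) :=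
          mul_le_mul hw1 hdiff (abs_nonneg _) zero_le_one
      _ ≤ ((Fintype.card ι : ℝ) + 1) * c₁ * FF * φ := by
          rw [one_mul, hFF]
          have := hmono2 (by positivity : 0 ≤ D + Db + Df)
          calc ((Fintype.card ι : ℝ) + 1) * (c₁ * Real.exp (-((D + Db + Df) / (2 * K₁))) * φ)
              = ((Fintype.card ι : ℝ) + 1) * c₁ * Real.exp (-((D + Db + Df) / (2 * K₁))) * φ := by ring
            _ ≤ ((Fintype.card ι : ℝ) + 1) * c₁ * Real.exp (-((D + Db + Df) / (2 * K))) * φ :=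
                mul_le_mul_of_nonneg_right (mul_le_mul_of_nonneg_left this (by positivity)) hφ
      _ ≤ cH * FF * φ := by
          refine mul_le_mul_of_nonneg_right (mul_le_mul_of_nonneg_right ?_ hFF0.le) hφ
          rw [hcH]
          have : 0 ≤ cT1 + c₂ * Real.exp (1 / K) * CK * Real.exp (4 / K) / (1 - r) + c₂ * Real.exp (2 / K) + 1 := by
            positivity
          linarith only [this]
  ---------------------------------------------------------------- close pairs
  push Not at hfar   -- sN ≤ n
  have hwle : wt * (sN / (((ℓ + 1) ^ k : ℕ) : ℝ)) ≤ 1 := holderWeight_mul_le_one hs1 hfar hα1.le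
  have hxx' : supNorm (x.1 - x'.1) ≤ (((ℓ + 1) ^ k : ℕ) : ℝ) := by rw [supNorm_sub_comm]; exact hfar
  -- the cutoff and the decomposition
  set χv : ↥(Box d ℓ k Ms) → ℝ := fun z => chi ((ℓ + 1) ^ k) Ms Mb (fun i => (o i : ℤ)) z.1 with hχv
  have hχL : ∀ z, Layer ℓ k Mb Ms o ho z → χv z = 0 := fun z hz => chi_eq_zero_of_layer ℓ k Mb Ms o ho hn z hz
  have hχ01 : ∀ z, 0 ≤ χv z ∧ χv z ≤ 1 := fun z =>
    ⟨B4Delta112ZeroBox.chi_nonneg _ _ _ _ _, B4Delta112ZeroBox.chi_le_one _ _ _ _ _⟩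
  have hsz := hsize_chi ℓ k Mb Ms o hn2 hMs
  have hdec := deltaG_decomp_fun ℓ k Mb Ms o F κ ho hℓ hk hn ha' hm1 A₀ χv hχL f
  rw [hsubF] at hdec
  set g := kOp F κ ((ℓ + 1) ^ k) (B1.aSeq a ((ℓ : ℝ) + 1) k) m2 Ms (baseEmb hn Ms) (stairContour hn Ms) AΩ χv *ᵥ u
    with hg
  set f₃ := mulH (ι := ι) (fun z => 1 - χv z) *ᵥ f with hf₃
  set hh : ↥(Box d ℓ k Ms) → ℝ := fun z => 1 - χv z with hhh
  -- `fld (D_ν δ) z = fld (D_ν(hh·u)) z − fld (D₀(G₀Eg)) (ez) − fld (D₀(G₀Ef₃)) (ez)` at `z ∈ {x, x′}`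
  have hfldz : ∀ (z : ↥(Box d ℓ k Ms)) (hz : z.1 + e1 ν ∈ Box d ℓ k Ms),
      fld (DνΩ *ᵥ δv) z = fld (DνΩ *ᵥ (mulH (ι := ι) hh *ᵥ u)) z
        - fld (Dν₀ *ᵥ (G₀ *ᵥ extV ℓ k Mb Ms o g)) (subEmb ℓ k Mb Ms o ho z)
        - fld (Dν₀ *ᵥ (G₀ *ᵥ extV ℓ k Mb Ms o f₃)) (subEmb ℓ k Mb Ms o ho z) := by
    intro z hz
    have h1 : δv = mulH (ι := ι) hh *ᵥ u - restrV ℓ k Mb Ms o ho (G₀ *ᵥ extV ℓ k Mb Ms o g)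
        - restrV ℓ k Mb Ms o ho (G₀ *ᵥ extV ℓ k Mb Ms o f₃) := hdec
    have hr1 := fld_derivA_restrV ℓ k Mb Ms o F κ ho A₀ (G₀ *ᵥ extV ℓ k Mb Ms o g) ν z hz
    have hr2 := fld_derivA_restrV ℓ k Mb Ms o F κ ho A₀ (G₀ *ᵥ extV ℓ k Mb Ms o f₃) ν z hz
    rw [hsubF] at hr1 hr2
    rw [h1, Matrix.mulVec_sub, Matrix.mulVec_sub, ← hr1, ← hr2]
    funext j
    simp only [fld_apply, Pi.sub_apply]
    rfl
  -- the three quotients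
  set V1 := fld (DνΩ *ᵥ (mulH (ι := ι) hh *ᵥ u)) with hV1
  set W2 := fld (Dν₀ *ᵥ (G₀ *ᵥ extV ℓ k Mb Ms o g)) with hW2
  set W3 := fld (Dν₀ *ᵥ (G₀ *ᵥ extV ℓ k Mb Ms o f₃)) with hW3
  have hLHS : (T *ᵥ fld (DνΩ *ᵥ δv) x' - fld (DνΩ *ᵥ δv) x) i
      = (T *ᵥ V1 x' - V1 x) i - (T *ᵥ W2 ex' - W2 ex) i - (T *ᵥ W3 ex' - W3 ex) i := by
    rw [hfldz x hxν, hfldz x' hx'ν]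
    simp only [Matrix.mulVec_sub, Pi.sub_apply]
    ring
  rw [hLHS]
  -- witnesses near `x` force `D_b ≤ 3` and `dist(x, P) ≥ (D_f − 3)n`
  set Dc : ℝ := max ((D + (Df - 3)) / 2) 0 with hDc
  have hDc0 : 0 ≤ Dc := le_max_right _ _
  set DA : ℝ := max (Dc - 1) 0 with hDA
  have hDA0 : 0 ≤ DA := le_max_right _ _
  have hbook : (∃ y : ↥(Box d ℓ k Mb), ¬ inSub ℓ k Mb Ms o y ∧ supNorm (ex.1 - y.1) ≤ 3 * (((ℓ + 1) ^ k : ℕ) : ℝ)) →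
      Db ≤ 3 ∧ (∀ x'', P x'' → Dc * (((ℓ + 1) ^ k : ℕ) : ℝ) ≤ supNorm (x.1 - x''.1)) ∧
        (∀ z : ↥(Box d ℓ k Ms), supNorm (x.1 - z.1) ≤ (((ℓ + 1) ^ k : ℕ) : ℝ) →
          ∀ x'', P x'' → DA * (((ℓ + 1) ^ k : ℕ) : ℝ) ≤ supNorm (z.1 - x''.1)) := by
    rintro ⟨y, hy, hdy⟩
    have hDcx : ∀ x'', P x'' → Dc * (((ℓ + 1) ^ k : ℕ) : ℝ) ≤ supNorm (x.1 - x''.1) := by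
      intro x'' hx''
      refine max_half_mul_le hnr.le (hDx x'' hx'') ?_ (supNorm_nonneg _)
      have t1 := supNorm_sub_le_sub_add_sub (subEmb ℓ k Mb Ms o ho x'').1 ex.1 y.1
      rw [hex, supNorm_subEmb_sub_subEmb, supNorm_sub_comm x''.1] at t1
      have := hDfx x'' hx'' y hy
      rw [sub_mul]
      linarith only [t1, this, hdy]
    refine ⟨?_, hDcx, ?_⟩
    · have := (hDbx y hy).trans hdy
      exact le_of_mul_le_mul_right (by linarith only [this]) hnr
    · intro z hz x'' hx''
      have t1 := supNorm_sub_le_sub_add_sub x.1 z.1 x''.1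
      have h1 := hDcx x'' hx''
      have hDA' : DA * (((ℓ + 1) ^ k : ℕ) : ℝ) ≤ max ((Dc - 1) * (((ℓ + 1) ^ k : ℕ) : ℝ)) 0 := by
        rw [hDA]
        rcases le_total (Dc - 1) 0 with hc | hc
        · rw [max_eq_right hc, zero_mul]; exact le_max_right _ _
        · rw [max_eq_left hc]; exact le_max_left _ _
      refine hDA'.trans (max_le ?_ (supNorm_nonneg _))
      rw [sub_mul, one_mul]
      linarith only [t1, h1, hz]
  have hwit : ∀ z : ↥(Box d ℓ k Ms), supNorm (x.1 - z.1) ≤ 2 * (((ℓ + 1) ^ k : ℕ) : ℝ) → χv z ≠ 1 →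
      ∃ y : ↥(Box d ℓ k Mb), ¬ inSub ℓ k Mb Ms o y ∧ supNorm (ex.1 - y.1) ≤ 3 * (((ℓ + 1) ^ k : ℕ) : ℝ) := by
    intro z hz hχz
    obtain ⟨y, hy, hd'⟩ := exists_out_of_chi_ne_one ℓ k Mb Ms o ho hn2 hMs z hχz
    refine ⟨y, hy, ?_⟩
    have t1 := supNorm_sub_le_sub_add_sub ex.1 (subEmb ℓ k Mb Ms o ho z).1 y.1
    rw [hex, supNorm_subEmb_sub_subEmb] at t1
    rw [hex]
    linarith only [t1, hd', hz]
  -- the four relevant sites are within `2n` of `x`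
  set xp : ↥(Box d ℓ k Ms) := ⟨x.1 + e1 ν, hxν⟩ with hxp
  set xp' : ↥(Box d ℓ k Ms) := ⟨x'.1 + e1 ν, hx'ν⟩ with hxp'
  have hnx : supNorm (x.1 - x.1) ≤ 2 * (((ℓ + 1) ^ k : ℕ) : ℝ) := by
    rw [sub_self, B4BoxCov237.supNorm_zero']; positivity
  have hnxp : supNorm (x.1 - xp.1) ≤ 2 * (((ℓ + 1) ^ k : ℕ) : ℝ) := by
    have := supNorm_sub_le_one_of_mem_nbrs (mem_nbrs.2 ⟨ν, Or.inl rfl⟩ : xp.1 ∈ nbrs x.1)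
    linarith only [this, hnr1]
  have hnx' : supNorm (x.1 - x'.1) ≤ 2 * (((ℓ + 1) ^ k : ℕ) : ℝ) := by linarith only [hxx', hnr.le]
  have hxpxp' : supNorm (xp'.1 - xp.1) = sN := by
    rw [hsN]; congr 1; simp only [hxp, hxp']; abel
  have hnxp' : supNorm (x.1 - xp'.1) ≤ 2 * (((ℓ + 1) ^ k : ℕ) : ℝ) := by
    have t1 := supNorm_sub_le_sub_add_sub x.1 x'.1 xp'.1
    have t2 : supNorm (x'.1 - xp'.1) ≤ 1 :=
      supNorm_sub_le_one_of_mem_nbrs (mem_nbrs.2 ⟨ν, Or.inl rfl⟩ : xp'.1 ∈ nbrs x'.1)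
    linarith only [t1, t2, hxx', hnr1]
  -- bookkeeping of the exponentials: `e^{−Dc/K'} ≤ e^{3/K}F`, `e^{−DA/K'} ≤ e^{4/K}F` once `Db ≤ 3`
  have hexpc : Db ≤ 3 → ∀ K' : ℕ, 1 ≤ K' → K' ≤ K → Real.exp (-(Dc / K')) ≤ Real.exp (4 / K) * FF := by
    intro hDb3 K' hK'1 hK'K
    refine (hmono K' hK'1 hK'K hDc0).trans (exp_bookkeeping hKr ?_)
    have : (D + (Df - 3)) / 2 ≤ Dc := le_max_left _ _
    linarith only [this, hDb3]
  have hexpA : Db ≤ 3 → ∀ K' : ℕ, 1 ≤ K' → K' ≤ K → Real.exp (-(DA / K')) ≤ Real.exp (4 / K) * FF := by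
    intro hDb3 K' hK'1 hK'K
    refine (hmono K' hK'1 hK'K hDA0).trans (exp_bookkeeping hKr ?_)
    have h1 : (D + (Df - 3)) / 2 ≤ Dc := le_max_left _ _
    have h2 : Dc - 1 ≤ DA := le_max_left _ _
    linarith only [h1, h2, hDb3]
  ---------------------------------------------------------------- T1'' : the Leibniz terms
  have hT1 : wt * |(T *ᵥ V1 x' - V1 x) i| ≤ cT1 * FF * φ := by
    -- Leibniz at `x` and `x′`
    have hLx : V1 x = hh xp • fld (DνΩ *ᵥ u) x + ((((ℓ + 1) ^ k : ℕ) : ℝ) * (hh xp - hh x)) • fld u x := by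
      rw [hV1, hDνΩ]; exact fld_derivA_mulH ℓ k F κ Ms AΩ hh u ν x hxν
    have hLx' : V1 x' = hh xp' • fld (DνΩ *ᵥ u) x' + ((((ℓ + 1) ^ k : ℕ) : ℝ) * (hh xp' - hh x')) • fld u x' := by
      rw [hV1, hDνΩ]; exact fld_derivA_mulH ℓ k F κ Ms AΩ hh u ν x' hx'ν
    set aa : ℝ := hh xp with haa
    set aa' : ℝ := hh xp' with haa'
    set bb : ℝ := (((ℓ + 1) ^ k : ℕ) : ℝ) * (hh xp - hh x) with hbb
    set bb' : ℝ := (((ℓ + 1) ^ k : ℕ) : ℝ) * (hh xp' - hh x') with hbb'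
    set Vu := fld (DνΩ *ᵥ u) with hVu
    set Uu := fld u with hUu
    have hsplit : T *ᵥ V1 x' - V1 x
        = aa' • (T *ᵥ Vu x' - Vu x) + (aa' - aa) • Vu x + bb' • (T *ᵥ Uu x' - Uu x) + (bb' - bb) • Uu x := by
      rw [hLx, hLx', Matrix.mulVec_add, Matrix.mulVec_smul, Matrix.mulVec_smul]
      module
    rw [hsplit]
    simp only [Pi.add_apply, Pi.smul_apply, smul_eq_mul]
    -- (A)
    have hA : wt * |aa' * (T *ᵥ Vu x' - Vu x) i| ≤ c₂ * Real.exp (4 / K) * FF * φ := by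
      by_cases h0 : aa' = 0
      · rw [h0, zero_mul, abs_zero, mul_zero]; positivity
      have hχ1 : χv xp' ≠ 1 := fun h => h0 (by rw [haa', hhh]; simp only [h, sub_self])
      obtain ⟨hDb3, -, hfarA⟩ := hbook (hwit xp' hnxp' hχ1)
      have hDAx : ∀ x'', P x'' → ∃ μ, DA ≤ |posR ℓ k Ms x μ - posR ℓ k Ms x'' μ| := fun x'' hx'' =>
        exists_coord_of_le_supNorm ℓ k Ms x x'' (hfarA x (by rw [sub_self, B4BoxCov237.supNorm_zero']; exact hnr.le) x'' hx'')
      have hDAx' : ∀ x'', P x'' → ∃ μ, DA ≤ |posR ℓ k Ms x' μ - posR ℓ k Ms x'' μ| := fun x'' hx'' =>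
        exists_coord_of_le_supNorm ℓ k Ms x' x'' (hfarA x' hxx' x'' hx'')
      have hH := HΩ ν x x' hxν hx'ν hne l hl hlend hlen hlnear P DA hDA0 hDAx hDAx' f hfP φ hφ hf i
      have haa1 : |aa'| ≤ 1 := by
        rw [haa', hhh]; obtain ⟨h0', h1'⟩ := hχ01 xp'
        rw [abs_of_nonneg (by linarith only [h1'])]; linarith only [h0']
      rw [abs_mul]
      calc wt * (|aa'| * |(T *ᵥ Vu x' - Vu x) i|) = |aa'| * (wt * |(T *ᵥ Vu x' - Vu x) i|) := by ring
        _ ≤ 1 * (c₂ * Real.exp (-(DA / K₂)) * φ) :=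
            mul_le_mul haa1 hH (mul_nonneg hwt0 (abs_nonneg _)) zero_le_one
        _ ≤ c₂ * (Real.exp (4 / K) * FF) * φ := by
            rw [one_mul]
            exact mul_le_mul_of_nonneg_right (mul_le_mul_of_nonneg_left (hexpA hDb3 K₂ hK₂1 hK₂K) hc₂.le) hφ
        _ = c₂ * Real.exp (4 / K) * FF * φ := by ring
    -- (B)
    have hB : wt * |(aa' - aa) * Vu x i| ≤ 8 * ((d : ℝ) + 1) * cd * Real.exp (4 / K) * FF * φ := by
      by_cases h0 : aa' - aa = 0
      · rw [h0, zero_mul, abs_zero, mul_zero]; positivity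
      have hne1 : χv xp ≠ 1 ∨ χv xp' ≠ 1 := by
        by_contra hc; push Not at hc
        exact h0 (by rw [haa, haa', hhh]; simp only [hc.1, hc.2, sub_self])
      obtain ⟨hDb3, hfarc, -⟩ := hbook (by
        rcases hne1 with h | h
        · exact hwit xp hnxp h
        · exact hwit xp' hnxp' h)
      have hDcP : ∀ x'', P x'' → ∃ μ, Dc ≤ |posR ℓ k Ms x μ - posR ℓ k Ms x'' μ| := fun x'' hx'' =>
        exists_coord_of_le_supNorm ℓ k Ms x x'' (hfarc x'' hx'')
      have hDu := DΩ ν x hxν P Dc hDcP f hfP φ hφ hf i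
      have hlip : |aa' - aa| ≤ 8 * ((d : ℝ) + 1) * sN / (((ℓ + 1) ^ k : ℕ) : ℝ) := by
        have := abs_chi_sub_le Ms Mb (fun i => (o i : ℤ)) hn (y := xp.1) (y' := xp'.1) xp.2 xp'.2
        rw [hxpxp'] at this
        rw [haa, haa', hhh]
        rw [show (1 - χv xp') - (1 - χv xp) = -(χv xp' - χv xp) by ring, abs_neg]
        exact this
      rw [abs_mul]
      have hVu : |Vu x i| ≤ cd * Real.exp (-(Dc / K₄)) * φ := by rw [hVu, fld_apply]; exact hDu
      calc wt * (|aa' - aa| * |Vu x i|)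
          ≤ wt * (8 * ((d : ℝ) + 1) * sN / (((ℓ + 1) ^ k : ℕ) : ℝ) * (cd * Real.exp (-(Dc / K₄)) * φ)) :=
            mul_le_mul_of_nonneg_left (mul_le_mul hlip hVu (abs_nonneg _) (by positivity)) hwt0
        _ = (wt * (sN / (((ℓ + 1) ^ k : ℕ) : ℝ))) * (8 * ((d : ℝ) + 1)) * (cd * Real.exp (-(Dc / K₄)) * φ) := by
            ring
        _ ≤ 1 * (8 * ((d : ℝ) + 1)) * (cd * (Real.exp (4 / K) * FF) * φ) := by
            refine mul_le_mul (mul_le_mul_of_nonneg_right hwle (by positivity)) ?_ (by positivity) (by positivity)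
            exact mul_le_mul_of_nonneg_right (mul_le_mul_of_nonneg_left (hexpc hDb3 K₄ hK₄1 hK₄K) hcd.le) hφ
        _ = 8 * ((d : ℝ) + 1) * cd * Real.exp (4 / K) * FF * φ := by ring
    -- (C)
    have hC : wt * |bb' * (T *ᵥ Uu x' - Uu x) i|
        ≤ 8 * ((d : ℝ) + 1) * Real.sqrt (Fintype.card ι) * cd * Real.exp (4 / K) * FF * φ := by
      by_cases h0 : bb' = 0
      · rw [h0, zero_mul, abs_zero, mul_zero]; positivity
      have hne1 : χv x' ≠ 1 ∨ χv xp' ≠ 1 := by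
        by_contra hc; push Not at hc
        exact h0 (by rw [hbb', hhh]; simp only [hc.1, hc.2, sub_self, mul_zero])
      obtain ⟨hDb3, -, hfarA⟩ := hbook (by
        rcases hne1 with h | h
        · exact hwit x' hnx' h
        · exact hwit xp' hnxp' h)
      have hbb8 : |bb'| ≤ 8 := by
        have hmem : xp' ∈ boxNbrs (fun j => (ℓ + 1) ^ k * Ms j) x' := by
          unfold boxNbrs; simpa using (mem_nbrs.2 ⟨ν, Or.inl rfl⟩ : xp'.1 ∈ nbrs x'.1)
        have := hsz.grad_le x' xp' hmem
        rw [hbb', hhh, show (1 - χv xp') - (1 - χv x') = -(χv xp' - χv x') by ring, mul_neg, abs_neg, abs_mul,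
          abs_of_nonneg hnr.le]
        exact this
      -- the derivative member on the chain sites
      set BD : ℝ := Real.sqrt (Fintype.card ι) * (cd * Real.exp (-(DA / K₄)) * φ) with hBD
      have hBD0 : 0 ≤ BD := by positivity
      have hchain : ∀ z : ↥(Box d ℓ k Ms), (z = x ∨ z ∈ l) → ∀ (μ' : Fin (d + 1)) (ze : ↥(Box d ℓ k Ms)),
          ze.1 = z.1 + e1 μ' → siteNorm (fieldLink F κ AΩ z ze *ᵥ fld u ze - fld u z) ≤ BD / (((ℓ + 1) ^ k : ℕ) : ℝ) := by
        intro z hz μ' ze hze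
        have hzx : supNorm (x.1 - z.1) ≤ (((ℓ + 1) ^ k : ℕ) : ℝ) := by
          rcases hz with rfl | hz
          · rw [sub_self, B4BoxCov237.supNorm_zero']; exact hnr.le
          · rw [supNorm_sub_comm]; exact (hlnear z hz).trans hfar
        have hzμ : z.1 + e1 μ' ∈ Box d ℓ k Ms := by rw [← hze]; exact ze.2
        have hDAz : ∀ x'', P x'' → ∃ μ, DA ≤ |posR ℓ k Ms z μ - posR ℓ k Ms x'' μ| := fun x'' hx'' =>
          exists_coord_of_le_supNorm ℓ k Ms z x'' (hfarA z hzx x'' hx'')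
        have hDz := DΩ μ' z hzμ P DA hDAz f hfP φ hφ hf
        have hcov : fld (derivA d F κ ℓ k Ms AΩ μ' *ᵥ u) z
            = (((ℓ + 1) ^ k : ℕ) : ℝ) • (fieldLink F κ AΩ z ze *ᵥ fld u ze - fld u z) := by
          have := fld_covDeriv_mulVec_of_mem ((ℓ + 1) ^ k) (fieldLink F κ AΩ) (μ := μ') u (x := z) hzμ
          have hze' : ze = ⟨z.1 + e1 μ', hzμ⟩ := Subtype.ext hze
          rw [hze']
          exact_mod_cast this
        have hnorm : siteNorm (fld (derivA d F κ ℓ k Ms AΩ μ' *ᵥ u) z) ≤ BD := by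
          refine (B4Thm112BoxValue.siteNorm_le_sqrt_card_mul _ (by positivity) fun j => ?_)
          rw [fld_apply]
          exact hDz j
        rw [hcov, siteNorm_smul, abs_of_nonneg hnr.le] at hnorm
        rw [le_div_iff₀ hnr, mul_comm]
        exact hnorm
      have htel := chain_covariation_local F κ hAas u x l hl hchain
      rw [hlend] at htel
      have hcomp : |(T *ᵥ Uu x' - Uu x) i| ≤ (l.length : ℝ) * (BD / (((ℓ + 1) ^ k : ℕ) : ℝ)) := by
        refine (B4Thm112BoxValue.abs_apply_le_siteNorm' _ i).trans ?_
        rw [hUu, hT]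
        exact htel
      rw [abs_mul]
      calc wt * (|bb'| * |(T *ᵥ Uu x' - Uu x) i|)
          ≤ wt * (8 * ((l.length : ℝ) * (BD / (((ℓ + 1) ^ k : ℕ) : ℝ)))) :=
            mul_le_mul_of_nonneg_left (mul_le_mul hbb8 hcomp (abs_nonneg _) (by norm_num)) hwt0
        _ ≤ wt * (8 * ((((d : ℝ) + 1) * sN) * (BD / (((ℓ + 1) ^ k : ℕ) : ℝ)))) := by
            refine mul_le_mul_of_nonneg_left (mul_le_mul_of_nonneg_left ?_ (by norm_num)) hwt0
            exact mul_le_mul_of_nonneg_right hlen (by positivity)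
        _ = (wt * (sN / (((ℓ + 1) ^ k : ℕ) : ℝ))) * (8 * ((d : ℝ) + 1)) * BD := by ring
        _ ≤ 1 * (8 * ((d : ℝ) + 1)) * (Real.sqrt (Fintype.card ι) * (cd * (Real.exp (4 / K) * FF) * φ)) := by
            refine mul_le_mul (mul_le_mul_of_nonneg_right hwle (by positivity)) ?_ hBD0 (by positivity)
            rw [hBD]
            refine mul_le_mul_of_nonneg_left ?_ (Real.sqrt_nonneg _)
            exact mul_le_mul_of_nonneg_right (mul_le_mul_of_nonneg_left (hexpA hDb3 K₄ hK₄1 hK₄K) hcd.le) hφ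
        _ = 8 * ((d : ℝ) + 1) * Real.sqrt (Fintype.card ι) * cd * Real.exp (4 / K) * FF * φ := by ring
    -- (D)
    have hDD : wt * |(bb' - bb) * Uu x i| ≤ 128 * ((d : ℝ) + 1) * cv * Real.exp (4 / K) * FF * φ := by
      by_cases h0 : bb' - bb = 0
      · rw [h0, zero_mul, abs_zero, mul_zero]; positivity
      have hne1 : (χv x ≠ 1 ∨ χv xp ≠ 1) ∨ (χv x' ≠ 1 ∨ χv xp' ≠ 1) := by
        by_contra hc; push Not at hc
        exact h0 (by rw [hbb, hbb', hhh]; simp only [hc.1.1, hc.1.2, hc.2.1, hc.2.2, sub_self, mul_zero])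
      obtain ⟨hDb3, hfarc, -⟩ := hbook (by
        rcases hne1 with (h | h) | (h | h)
        · exact hwit x hnx h
        · exact hwit xp hnxp h
        · exact hwit x' hnx' h
        · exact hwit xp' hnxp' h)
      have hDcP : ∀ x'', P x'' → ∃ μ, Dc ≤ |posR ℓ k Ms x μ - posR ℓ k Ms x'' μ| := fun x'' hx'' =>
        exists_coord_of_le_supNorm ℓ k Ms x x'' (hfarc x'' hx'')
      have hux := VΩ x P Dc hDcP f hfP φ hφ hf i
      have hlip : |bb' - bb| ≤ 128 * ((d : ℝ) + 1) * sN / (((ℓ + 1) ^ k : ℕ) : ℝ) := by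
        have := abs_dchi_sub_le Ms Mb (fun i => (o i : ℤ)) hn ν (y := x.1) (ye := xp.1) (y' := x'.1)
          (ye' := xp'.1) x.2 xp.2 x'.2 xp'.2 (by simp [hxp, e1]) (by simp [hxp', e1])
        rw [← hsN] at this
        rw [hbb, hbb', hhh]
        rw [show (((ℓ + 1) ^ k : ℕ) : ℝ) * ((1 - χv xp') - (1 - χv x')) - (((ℓ + 1) ^ k : ℕ) : ℝ) * ((1 - χv xp) - (1 - χv x))
            = -((((ℓ + 1) ^ k : ℕ) : ℝ) * (χv xp' - χv x') - (((ℓ + 1) ^ k : ℕ) : ℝ) * (χv xp - χv x)) by ring,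
          abs_neg]
        exact this
      have hUx : |Uu x i| ≤ cv * Real.exp (-(Dc / K₃)) * φ := by rw [hUu, fld_apply]; exact hux
      rw [abs_mul]
      calc wt * (|bb' - bb| * |Uu x i|)
          ≤ wt * (128 * ((d : ℝ) + 1) * sN / (((ℓ + 1) ^ k : ℕ) : ℝ) * (cv * Real.exp (-(Dc / K₃)) * φ)) :=
            mul_le_mul_of_nonneg_left (mul_le_mul hlip hUx (abs_nonneg _) (by positivity)) hwt0
        _ = (wt * (sN / (((ℓ + 1) ^ k : ℕ) : ℝ))) * (128 * ((d : ℝ) + 1)) * (cv * Real.exp (-(Dc / K₃)) * φ) := by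
            ring
        _ ≤ 1 * (128 * ((d : ℝ) + 1)) * (cv * (Real.exp (4 / K) * FF) * φ) := by
            refine mul_le_mul (mul_le_mul_of_nonneg_right hwle (by positivity)) ?_ (by positivity) (by positivity)
            exact mul_le_mul_of_nonneg_right (mul_le_mul_of_nonneg_left (hexpc hDb3 K₃ hK₃1 hK₃K) hcv.le) hφ
        _ = 128 * ((d : ℝ) + 1) * cv * Real.exp (4 / K) * FF * φ := by ring
    -- sum
    have hsum : |aa' * (T *ᵥ Vu x' - Vu x) i + (aa' - aa) * Vu x i + bb' * (T *ᵥ Uu x' - Uu x) i + (bb' - bb) * Uu x i|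
        ≤ |aa' * (T *ᵥ Vu x' - Vu x) i| + |(aa' - aa) * Vu x i| + |bb' * (T *ᵥ Uu x' - Uu x) i|
          + |(bb' - bb) * Uu x i| := by
      refine (abs_add_le _ _).trans (add_le_add ((abs_add_le _ _).trans (add_le_add (abs_add_le _ _) le_rfl)) le_rfl)
    calc wt * |aa' * (T *ᵥ Vu x' - Vu x) i + (aa' - aa) * Vu x i + bb' * (T *ᵥ Uu x' - Uu x) i + (bb' - bb) * Uu x i|
        ≤ wt * (|aa' * (T *ᵥ Vu x' - Vu x) i| + |(aa' - aa) * Vu x i| + |bb' * (T *ᵥ Uu x' - Uu x) i|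
          + |(bb' - bb) * Uu x i|) := mul_le_mul_of_nonneg_left hsum hwt0
      _ = wt * |aa' * (T *ᵥ Vu x' - Vu x) i| + wt * |(aa' - aa) * Vu x i| + wt * |bb' * (T *ᵥ Uu x' - Uu x) i|
          + wt * |(bb' - bb) * Uu x i| := by ring
      _ ≤ c₂ * Real.exp (4 / K) * FF * φ + 8 * ((d : ℝ) + 1) * cd * Real.exp (4 / K) * FF * φ
          + 8 * ((d : ℝ) + 1) * Real.sqrt (Fintype.card ι) * cd * Real.exp (4 / K) * FF * φ
          + 128 * ((d : ℝ) + 1) * cv * Real.exp (4 / K) * FF * φ :=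
          add_le_add (add_le_add (add_le_add hA hB) hC) hDD
      _ = cT1 * FF * φ := by rw [hcT1]; ring
  ---------------------------------------------------------------- T2'' : the commutator term, annular bound
  have hT2 : wt * |(T *ᵥ W2 ex' - W2 ex) i| ≤ c₂ * Real.exp (1 / K) * CK * Real.exp (4 / K) / (1 - r) * FF * φ := by
    -- the source facts
    have hval : ∀ (a'' : ↥(Box d ℓ k Ms)) (D' : ℝ), 0 ≤ D' →
        (∀ x'', P x'' → D' * (((ℓ + 1) ^ k : ℕ) : ℝ) ≤ supNorm (a''.1 - x''.1)) →
        ∀ j, |u (a'', j)| ≤ cv * Real.exp (-(D' / K)) * φ := by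
      intro a'' D' hD'0 hD'' j
      have := VΩ a'' P D' (fun x'' hx'' => exists_coord_of_le_supNorm ℓ k Ms a'' x'' (hD'' x'' hx'')) f hfP φ hφ hf j
      exact this.trans (mul_le_mul_of_nonneg_right (mul_le_mul_of_nonneg_left (hmono K₃ hK₃1 hK₃K hD'0) hcv.le) hφ)
    have hder : ∀ (a'' : ↥(Box d ℓ k Ms)) (μ : Fin (d + 1)), a''.1 + e1 μ ∈ Box d ℓ k Ms → ∀ (D' : ℝ), 0 ≤ D' →
        (∀ x'', P x'' → D' * (((ℓ + 1) ^ k : ℕ) : ℝ) ≤ supNorm (a''.1 - x''.1)) →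
        ∀ j, |(derivA d F κ ℓ k Ms AΩ μ *ᵥ u) (a'', j)| ≤ cd * Real.exp (-(D' / K)) * φ := by
      intro a'' μ hμ D' hD'0 hD'' j
      have := DΩ μ a'' hμ P D' (fun x'' hx'' => exists_coord_of_le_supNorm ℓ k Ms a'' x'' (hD'' x'' hx''))
        f hfP φ hφ hf j
      exact this.trans (mul_le_mul_of_nonneg_right (mul_le_mul_of_nonneg_left (hmono K₄ hK₄1 hK₄K hD'0) hcd.le) hφ)
    have hsrc := source_facts ℓ k Mb Ms o F κ ho hℓ hk hn hMs ha ha1 ha2 m2 Ac' u x P hcv.le hcd.le hφ hDx hDbx hDfx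
      hval hder
    -- the functional and its row bound
    set R : (↥(Box d ℓ k Mb) × ι → ℝ) → ℝ := fun src =>
      wt * ((T *ᵥ fld (Dν₀ *ᵥ (G₀ *ᵥ src)) ex') i - fld (Dν₀ *ᵥ (G₀ *ᵥ src)) ex i) with hR
    have hRsum : ∀ (s : Finset ℕ) (v : ℕ → ↥(Box d ℓ k Mb) × ι → ℝ), R (∑ m ∈ s, v m) = ∑ m ∈ s, R (v m) := by
      intro s v
      simp only [hR, Matrix.mulVec_sum, fld_sum', Finset.sum_apply, ← Finset.mul_sum, Finset.sum_sub_distrib]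
    have hRrow : ∀ (Pm : ↥(Box d ℓ k Mb) → Prop) [DecidablePred Pm] (m : ℕ),
        (∀ y, Pm y → (m : ℝ) * (((ℓ + 1) ^ k : ℕ) : ℝ) ≤ supNorm ((subEmb ℓ k Mb Ms o ho x).1 - y.1)) →
        ∀ src : ↥(Box d ℓ k Mb) × ι → ℝ, (∀ q, ¬ Pm q.1 → src q = 0) → ∀ φ' : ℝ, 0 ≤ φ' →
        (∀ q, |src q| ≤ φ') → |R src| ≤ c₂ * Real.exp (1 / K) * Real.exp (-((m : ℝ) / K)) * φ' := by
      intro Pm _ m hPm src hsupp φ' hφ' hbd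
      set Dm : ℝ := max ((m : ℝ) - 1) 0 with hDm
      have hDm0 : 0 ≤ Dm := le_max_right _ _
      have hDmx : ∀ y, Pm y → ∃ μ, Dm ≤ |posR ℓ k Mb ex μ - posR ℓ k Mb y μ| := by
        intro y hy
        refine exists_coord_of_le_supNorm ℓ k Mb ex y ?_
        have h1 : (m : ℝ) * (((ℓ + 1) ^ k : ℕ) : ℝ) ≤ supNorm (ex.1 - y.1) := hPm y hy
        rw [hDm]
        rcases le_total ((m : ℝ) - 1) 0 with hc | hc
        · rw [max_eq_right hc, zero_mul]; exact supNorm_nonneg _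
        · rw [max_eq_left hc, sub_mul, one_mul]; linarith only [h1, hnr.le]
      have hDmx' : ∀ y, Pm y → ∃ μ, Dm ≤ |posR ℓ k Mb ex' μ - posR ℓ k Mb y μ| := by
        intro y hy
        refine exists_coord_of_le_supNorm ℓ k Mb ex' y ?_
        have t1 := supNorm_sub_le_sub_add_sub ex.1 ex'.1 y.1
        have t2 : supNorm (ex.1 - ex'.1) = sN := by rw [supNorm_sub_comm]; exact hsNe
        rw [t2] at t1
        have h1 : (m : ℝ) * (((ℓ + 1) ^ k : ℕ) : ℝ) ≤ supNorm (ex.1 - y.1) := hPm y hy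
        rw [hDm]
        rcases le_total ((m : ℝ) - 1) 0 with hc | hc
        · rw [max_eq_right hc, zero_mul]; exact supNorm_nonneg _
        · rw [max_eq_left hc, sub_mul, one_mul]; linarith only [t1, h1, hfar]
      have hH := HΩ₀ ν ex ex' (subEmb_add_e1_mem ℓ k Mb Ms o ho x ν hxν) (subEmb_add_e1_mem ℓ k Mb Ms o ho x' ν hx'ν)
        hexne (l.map (subEmb ℓ k Mb Ms o ho)) hle' hlend' hlen' hlnear' Pm Dm hDm0 hDmx hDmx' src hsupp φ' hφ' hbd i
      rw [hTe, hsNe] at hH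
      have hexp : Real.exp (-(Dm / K₂)) ≤ Real.exp (1 / K) * Real.exp (-((m : ℝ) / K)) := by
        refine (hmono K₂ hK₂1 hK₂K hDm0).trans ?_
        rw [← Real.exp_add, Real.exp_le_exp]
        have : (m : ℝ) - 1 ≤ Dm := le_max_left _ _
        rw [show 1 / (K : ℝ) + -((m : ℝ) / K) = (-(m - 1)) / K by ring, show -(Dm / (K : ℝ)) = (-Dm) / K by ring]
        exact div_le_div_of_nonneg_right (by linarith only [this]) hKr.le
      rw [hR, abs_mul, abs_of_nonneg hwt0]
      calc wt * |(T *ᵥ fld (Dν₀ *ᵥ (G₀ *ᵥ src)) ex') i - fld (Dν₀ *ᵥ (G₀ *ᵥ src)) ex i|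
          = wt * |(T *ᵥ fld (Dν₀ *ᵥ (G₀ *ᵥ src)) ex' - fld (Dν₀ *ᵥ (G₀ *ᵥ src)) ex) i| := by
            rw [Pi.sub_apply]
        _ ≤ c₂ * Real.exp (-(Dm / K₂)) * φ' := hH
        _ ≤ c₂ * (Real.exp (1 / K) * Real.exp (-((m : ℝ) / K))) * φ' :=
            mul_le_mul_of_nonneg_right (mul_le_mul_of_nonneg_left hexp hc₂.le) hφ'
        _ = c₂ * Real.exp (1 / K) * Real.exp (-((m : ℝ) / K)) * φ' := by ring
    have hann := annular_bound ℓ k Mb Ms o ho x g R hRsum hKr (by positivity : 0 ≤ c₂ * Real.exp (1 / K)) hCK0 hφ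
      (fun m => max (max (D - m - 2) (Df - 3)) 0)
      (fun m => by
        show ((D - (m : ℝ) - 2) + (Df - 3)) / 2 ≤ max (max (D - (m : ℝ) - 2) (Df - 3)) 0
        have h1 : D - m - 2 ≤ max (max (D - (m : ℝ) - 2) (Df - 3)) 0 := (le_max_left _ _).trans (le_max_left _ _)
        have h2 : Df - 3 ≤ max (max (D - (m : ℝ) - 2) (Df - 3)) 0 := (le_max_right _ _).trans (le_max_left _ _)
        linarith only [h1, h2])
      hRrow hsrc
    have hRg : R (extV ℓ k Mb Ms o g) = wt * (T *ᵥ W2 ex' - W2 ex) i := by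
      simp only [hR, hW2, Pi.sub_apply]
    rw [hRg, abs_mul, abs_of_nonneg hwt0] at hann
    simpa only [hr] using hann
  ---------------------------------------------------------------- T3'' : the cut source term
  have hT3 : wt * |(T *ᵥ W3 ex' - W3 ex) i| ≤ c₂ * Real.exp (2 / K) * FF * φ := by
    have hf₃v : ∀ q, f₃ q = (1 - χv q.1) * f q := fun q => mulH_mulVec_apply _ _ q
    by_cases hP3 : ∃ a₀, P a₀ ∧ χv a₀ ≠ 1
    · obtain ⟨a₀, ha₀P, ha₀χ⟩ := hP3
      obtain ⟨y₀, hy₀, hd₀⟩ := exists_out_of_chi_ne_one ℓ k Mb Ms o ho hn2 hMs a₀ ha₀χ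
      have hDf1 : Df ≤ 1 := by
        have := (hDfx a₀ ha₀P y₀ hy₀).trans hd₀
        exact le_of_mul_le_mul_right (by linarith only [this]) hnr
      set D₃ : ℝ := max ((D + (Db - 1)) / 2 - 1) 0 with hD₃
      have hD₃0 : 0 ≤ D₃ := le_max_right _ _
      set P₃ : ↥(Box d ℓ k Mb) → Prop := fun y => ∃ a', subEmb ℓ k Mb Ms o ho a' = y ∧ P a' ∧ χv a' ≠ 1 with hP₃
      haveI hP₃d : DecidablePred P₃ := Classical.decPred P₃
      have hP₃dist : ∀ y, P₃ y → max ((D + (Db - 1)) / 2) 0 * (((ℓ + 1) ^ k : ℕ) : ℝ) ≤ supNorm (ex.1 - y.1) := by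
        rintro y ⟨a', rfl, ha'P, ha'χ⟩
        obtain ⟨y', hy', hd'⟩ := exists_out_of_chi_ne_one ℓ k Mb Ms o ho hn2 hMs a' ha'χ
        refine max_half_mul_le hnr.le ?_ ?_ (supNorm_nonneg _)
        · rw [hex, supNorm_subEmb_sub_subEmb]; exact hDx a' ha'P
        · have t1 := supNorm_sub_le_sub_add_sub ex.1 (subEmb ℓ k Mb Ms o ho a').1 y'.1
          have := hDbx y' hy'
          rw [sub_mul, one_mul]
          linarith only [t1, this, hd']
      have hD₃le : ∀ s' : ℝ, max ((D + (Db - 1)) / 2) 0 * (((ℓ + 1) ^ k : ℕ) : ℝ) - (((ℓ + 1) ^ k : ℕ) : ℝ) ≤ s' →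
          0 ≤ s' → D₃ * (((ℓ + 1) ^ k : ℕ) : ℝ) ≤ s' := by
        intro s' h1 h0
        rw [hD₃]
        rcases le_total ((D + (Db - 1)) / 2 - 1) 0 with hc | hc
        · rw [max_eq_right hc, zero_mul]; exact h0
        · rw [max_eq_left hc]
          have : max ((D + (Db - 1)) / 2) 0 = (D + (Db - 1)) / 2 := max_eq_left (by linarith only [hc])
          rw [this] at h1
          rw [sub_mul, one_mul]; exact h1
      have hD₃P : ∀ y, P₃ y → ∃ μ, D₃ ≤ |posR ℓ k Mb ex μ - posR ℓ k Mb y μ| := fun y hy =>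
        exists_coord_of_le_supNorm ℓ k Mb ex y
          (hD₃le _ (by linarith only [hP₃dist y hy, hnr.le]) (supNorm_nonneg _))
      have hD₃P' : ∀ y, P₃ y → ∃ μ, D₃ ≤ |posR ℓ k Mb ex' μ - posR ℓ k Mb y μ| := by
        intro y hy
        refine exists_coord_of_le_supNorm ℓ k Mb ex' y (hD₃le _ ?_ (supNorm_nonneg _))
        have t1 := supNorm_sub_le_sub_add_sub ex.1 ex'.1 y.1
        have t2 : supNorm (ex.1 - ex'.1) = sN := by rw [supNorm_sub_comm]; exact hsNe
        rw [t2] at t1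
        linarith only [t1, hP₃dist y hy, hfar]
      have hsupp : ∀ q : ↥(Box d ℓ k Mb) × ι, ¬ P₃ q.1 → extV ℓ k Mb Ms o f₃ q = 0 := by
        intro q hq
        by_cases hqi : inSub ℓ k Mb Ms o q.1
        · obtain ⟨a', ha'⟩ := (inSub_iff ℓ k Mb Ms o ho _).mp hqi
          have hq' : q = (subEmb ℓ k Mb Ms o ho a', q.2) := Prod.ext ha'.symm rfl
          rw [hq', extV_subEmb, hf₃v]
          by_cases hPa : P a'
          · have hχa : χv a' = 1 := by
              by_contra hc; exact hq ⟨a', ha', hPa, hc⟩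
            simp only [hχa, sub_self, zero_mul]
          · rw [hfP (a', q.2) hPa, mul_zero]
        · exact extV_of_not_inSub ℓ k Mb Ms o f₃ hqi
      have hbd : ∀ q : ↥(Box d ℓ k Mb) × ι, |extV ℓ k Mb Ms o f₃ q| ≤ φ := by
        intro q
        by_cases hqi : inSub ℓ k Mb Ms o q.1
        · obtain ⟨a', ha'⟩ := (inSub_iff ℓ k Mb Ms o ho _).mp hqi
          have hq' : q = (subEmb ℓ k Mb Ms o ho a', q.2) := Prod.ext ha'.symm rfl
          rw [hq', extV_subEmb, hf₃v, abs_mul]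
          obtain ⟨h0, h1⟩ := hχ01 a'
          calc |1 - χv a'| * |f (a', q.2)| ≤ 1 * φ :=
                mul_le_mul (by rw [abs_of_nonneg (by linarith only [h1])]; linarith only [h0]) (hf _)
                  (abs_nonneg _) zero_le_one
            _ = φ := one_mul φ
        · rw [extV_of_not_inSub ℓ k Mb Ms o f₃ hqi, abs_zero]; exact hφ
      have h3 := HΩ₀ ν ex ex' (subEmb_add_e1_mem ℓ k Mb Ms o ho x ν hxν) (subEmb_add_e1_mem ℓ k Mb Ms o ho x' ν hx'ν)
        hexne (l.map (subEmb ℓ k Mb Ms o ho)) hle' hlend' hlen' hlnear' P₃ D₃ hD₃0 hD₃P hD₃P' (extV ℓ k Mb Ms o f₃)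
        hsupp φ hφ hbd i
      rw [hTe, hsNe] at h3
      have hexp : Real.exp (-(D₃ / K₂)) ≤ Real.exp (2 / K) * FF :=
        (hmono K₂ hK₂1 hK₂K hD₃0).trans (exp_bookkeeping hKr (by
          have : (D + (Db - 1)) / 2 - 1 ≤ D₃ := le_max_left _ _
          linarith only [this, hDf1]))
      calc wt * |(T *ᵥ W3 ex' - W3 ex) i| = wt * |(T *ᵥ W3 ex' - W3 ex) i| := rfl
        _ ≤ c₂ * Real.exp (-(D₃ / K₂)) * φ := by rw [hW3]; exact h3
        _ ≤ c₂ * (Real.exp (2 / K) * FF) * φ :=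
            mul_le_mul_of_nonneg_right (mul_le_mul_of_nonneg_left hexp hc₂.le) hφ
        _ = c₂ * Real.exp (2 / K) * FF * φ := by ring
    · push Not at hP3
      have hf₃0 : f₃ = 0 := by
        funext q
        rw [hf₃v]
        by_cases hPq : P q.1
        · rw [hP3 q.1 hPq, sub_self, zero_mul]; rfl
        · rw [hfP q hPq, mul_zero]; rfl
      have hE0 : extV ℓ k Mb Ms o f₃ = 0 := by
        funext q; rw [hf₃0]; simp [extV]
      have hW30 : W3 = fun _ => 0 := by
        rw [hW3, hE0, Matrix.mulVec_zero, Matrix.mulVec_zero]; funext z; funext j; simp [fld_apply]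
      rw [hW30, Matrix.mulVec_zero, sub_zero, Pi.zero_apply, abs_zero, mul_zero]
      positivity
  ---------------------------------------------------------------- total
  have htot : wt * |(T *ᵥ V1 x' - V1 x) i - (T *ᵥ W2 ex' - W2 ex) i - (T *ᵥ W3 ex' - W3 ex) i|
      ≤ cT1 * FF * φ + c₂ * Real.exp (1 / K) * CK * Real.exp (4 / K) / (1 - r) * FF * φ + c₂ * Real.exp (2 / K) * FF * φ := by
    have h := abs_sub (((T *ᵥ V1 x' - V1 x) i - (T *ᵥ W2 ex' - W2 ex) i)) ((T *ᵥ W3 ex' - W3 ex) i)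
    have h' := abs_sub ((T *ᵥ V1 x' - V1 x) i) ((T *ᵥ W2 ex' - W2 ex) i)
    have := mul_le_mul_of_nonneg_left (h.trans (add_le_add h' le_rfl)) hwt0
    refine this.trans ?_
    rw [mul_add, mul_add]
    exact add_le_add (add_le_add hT1 hT2) hT3
  refine htot.trans ?_
  have : cT1 * FF * φ + c₂ * Real.exp (1 / K) * CK * Real.exp (4 / K) / (1 - r) * FF * φ + c₂ * Real.exp (2 / K) * FF * φ
      = (cT1 + c₂ * Real.exp (1 / K) * CK * Real.exp (4 / K) / (1 - r) + c₂ * Real.exp (2 / K)) * FF * φ := by ring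
  rw [this, hFF]
  refine mul_le_mul_of_nonneg_right (mul_le_mul_of_nonneg_right ?_ hFF0.le) hφ
  rw [hcH]
  have : 0 ≤ ((Fintype.card ι : ℝ) + 1) * c₁ := by positivity
  linarith only [this]

end

end Literature.MathematicalPhysics.QuantumFieldTheory.Balaban1983to89.B4Thm112BoxNoCollar
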